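import Literature.ComputerArithmetic.Rump2009.FastAccSum

/-!
# Rump 2012: error estimation of floating-point summation and dot product — the `ufp` bounds
# `(n−1)u·ufp(S̃)` (Theorem 3.5), `(n+2)u·ufp(S̃) + realmin` (Theorem 4.3) and the bounds
# COMPUTABLE IN ROUNDING TO NEAREST (Corollaries 3.7 and 4.4)

HONEST FRAMING (ENGINES group, unit `eng-quad-4`, kernels lane of the `certquad` engine — shared
numerical engines serving client cells; rigour lives in the verifiers; every published number
belongs to a client cell's ledger, not to the engines group): this file continues the lane's typed
summation / dot-product literature (`RumpOgitaOishi2008.*`, `Rump2009.FastAccSum`,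
`JeannerodRump2013.InnerProduct`, `JeannerodRump2018.Theorem41`) with the paper that removes the
`O(u²)` terms from the classical Wilkinson-type bounds AND shows how to obtain a rigorous error bound
by a handful of floating-point operations IN ROUNDING TO NEAREST (no directed rounding, no change of
rounding mode) — the situation of a kernel that returns a value together with its own error bound
computed in the same arithmetic. FORMAT LEVEL throughout: the tree's binary floating-point numbers
`JeannerodRump2018.IsFloat p emin` (precision `p`, gradual underflow from the quantum exponent `emin`,
NO overflow: every "barring overflow" proviso of the source is vacuous here), a round-to-nearest map
`JeannerodRump2018.IsRoundNearest p emin fl`, `u = unitRoundoff p = 2^-p`, `eta = 2^emin`,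
`realmin = ½u⁻¹eta = 2^(emin+p-1)`, and the format-free unit in the first place
`RumpOgitaOishi2008.ufp` (`ufp r = 2^⌊log₂|r|⌋`, `ufp 0 = 0`). Carrier `ℚ` (all data of the statements
— floating-point numbers, their sums and products, powers of two — are rational).

Typed and PROVED here: Lemma 3.3; THEOREM 3.4 (`|s̃ₙ − Σpᵢ| ≤ (n−1)u·Σ|pᵢ|`, no restriction on `n`,
by the source's own two-case induction); (3.8); the monotonicity (3.9)/(3.10); THEOREM 3.5
(`|s̃ₙ − Σpᵢ| ≤ (n−1)u·ufp(S̃ₙ) ≤ (n−1)u·S̃ₙ`) with its sharpness example; the exactness of both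
recursive sums below `u⁻¹eta`; COROLLARY 3.7 (`|s̃ₙ − Σpᵢ| ≤ fl((n−1)·fl(u·ufp(S̃ₙ)))`, `nu ≤ 1`, also
with `ufp` computed by Algorithm 3.6 = `Rump2009.ufpFl`) with its sharpness example; the rounding
facts (2.9)–(2.11) in the form used (`|fl(t) − t| ≤ u|fl(t)| + eta/2`, split at `realmin`);
THEOREM 4.3 (`|s̃ₙ − xᵀy| ≤ (n+2)u·ufp(S̃ₙ) + n·eta/2 < (n+2)u·ufp(S̃ₙ) + realmin`) and
COROLLARY 4.4 (`|s̃ₙ − xᵀy| ≤ R̃, R̂` for `R̃ = float((n+2)·(u·r) + ϱ)`, `R̂ = float(((n+2)·u)·r + ϱ)`,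
`r = ufp(S̃ₙ)`, with `ϱ = realmin` under `2(n+2)u ≤ 1` and `ϱ = 3/2·realmin` under `(n+2)u ≤ 1`),
including the case analysis near and in the underflow range. Three SCOPE facts the typing surfaced
are recorded as theorems (see 'Reading notes' below): (2.8) needs `fl(r) ≠ 0`; (3.9)/(3.10) and hence
Theorem 3.5 ff. are typed for round-to-nearest maps with a SIGN-SYMMETRIC tie rule `fl(−t) = −fl(t)`
(both IEEE 754 nearest modes), the source's "any rounding of the tie" being too generous for (3.9);
and the first `<` of (4.2) is a `≤` when `S̃ₙ = 0` (it is strict as soon as `S̃ₙ ≠ 0`).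
NOT typed: the introductory classical bounds (3.1)–(3.3) and (4.1) (Higham-type `γₙ` bounds, in the
tree as `JeannerodRump2013.abs_dot_sub_le_gamma` etc.), (2.7) (used by the source only inside the
proof of Lemma 3.3, which the tree proves directly), Remark 5 (the counterexample showing that
`(n−1)u·ufp(Σ|pᵢ|)` is NOT a bound), the example (4.5) showing that `n+2` cannot be replaced by `n+1`
in (4.2), the remark on directed roundings (`2u` for `u`), Remark 4 (`n > u⁻¹`), and §5 (timings and
test matrices).

Source read at the page: [Rump2012] S. M. Rump, *Error estimation of floating-point summation and dot
product*, BIT Numer. Math. 52(1) (2012) 201–220, doi:10.1007/s10543-011-0342-4, read in the author's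
accepted version (Ru11.pdf, "accepted for publication in BIT, May 18, 2011"; the journal PDF was not
available to the lane), whose numbering is used in the cite tags: p. 2 (§2: `u`, `eta`, (2.1)–(2.5)),
p. 3 ((2.6)–(2.11); §3, Algorithm 3.1, (3.1), Algorithm 3.2), p. 4 ((3.2)–(3.4), Lemma 3.3 with proof,
Theorem 3.4, (3.5)–(3.7)), p. 5 (proof of Theorem 3.4, Remark 2, (3.8)–(3.10), Theorem 3.5, (3.11)),
p. 6 (proof of Theorem 3.5 with the sharpness example, Algorithm 3.6, Corollary 3.7, (3.12), Remarks
4–5), p. 7 (§4, Algorithms 4.1–4.2, (4.1), Theorem 4.3, (4.2), Remarks 6–7, (4.3)–(4.4)), p. 8 (proof of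
Theorem 4.3, (4.5), Corollary 4.4, (4.6)), pp. 9–10 ((4.7), Remarks 8–9, proof of Corollary 4.4,
(4.8)–(4.9)).

DICTIONARY (source ↦ here): `F ↦ IsFloat p emin`, `fl ↦ fl` with `IsRoundNearest p emin fl` (plus
`hsym : ∀ t, fl (−t) = −fl t` where stated), `u ↦ unitRoundoff p`, `eta ↦ 2^emin`,
`u⁻¹eta ↦ 2^(emin+p)`, `realmin = ½u⁻¹eta ↦ 2^(emin+p-1)`, `u⁻¹realmin ↦ 2^(emin+2p-1)`, `ufp ↦ ufp`.
* Algorithm 3.1 (`s̃ₙ`, recursive summation from the left) ↦ `RumpOgitaOishi2008.flSum fl p`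
  (`= Rump2009.flAcc fl p₁ [p₂,…,pₙ]`); Algorithm 3.2's companion `S̃ₙ = fl-sum of |pᵢ|` in the SAME
  order ↦ `flSumAbs fl p := flSum fl (p.map |·|)`; Algorithm 3.6 ↦ `Rump2009.ufpFl` (= Algorithm 3.5 of
  [Rump2009], exact by `Rump2009.ufpFl_eq_ufp`); the bound `R̃` of (3.12) ↦ `sumErrBound fl p n r`.
* Algorithms 4.1/4.2 (`p̃ᵢ = fl(xᵢyᵢ)`, `s̃ₙ`, `S̃ₙ`) ↦ `flProducts fl x y := (zipWith (·*·) x y).map fl`,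
  `flDot`, `flDotAbs`. The analysis of §4 uses of `pᵢ = xᵢyᵢ` only that `p̃ᵢ = fl(pᵢ)`; the theorems are
  therefore typed for an ARBITRARY list `qs` of rationals with `p̃ = qs.map fl` (the dot product being
  the instance `qs = zipWith (·*·) x y`, `theorem43_dot`, `corollary44_dot`), and `x, y ∈ Fⁿ` is not
  needed. `R̃`, `R̂` of (4.6) ↦ `dotErrBound₁ fl p n ϱ r`, `dotErrBound₂ fl p n ϱ r`.
* (2.6) ↦ `RumpOgitaOishi2008.ufp_le_abs` / `abs_lt_two_mul_ufp` (and `abs_le_two_mul_ufp` here);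
  (2.8) ↦ `RumpOgitaOishi2008.ufp_le_ufp_fl` (hypothesis `fl r ≠ 0`) and `eq28_fails_at_quarter_eta`;
  (2.9)–(2.11) ↦ `RumpOgitaOishi2008.abs_fl_sub_le_u_ufp`, `abs_fl_add_sub_le_u_ufp`,
  `ufp_add_le_ufp_fl_add`, `JeannerodRump2013.abs_fl_sub_le_half_eta`, and here
  `abs_fl_sub_le_u_abs_fl_of_le`, `abs_fl_sub_le_half_eta_of_abs_fl_lt`, `abs_fl_sub_le_u_abs_fl_add`;
  Lemma 3.3 ↦ `lemma33` (= `JeannerodRump2018.abs_err_le_abs_operand`); Theorem 3.4 ↦ `theorem34`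
  (accumulator form `theorem34_acc`); (3.8) ↦ `eq38`; (3.9) ↦ `mono39` (with `abs_fl_eq_fl_abs`);
  (3.10) ↦ `eq310`; Theorem 3.5 ↦ `theorem35`, `theorem35'`, `theorem35_sharp`; (2.3)-exactness of
  Algorithm 3.2 below `u⁻¹eta` ↦ `flSum_exact_of_flSumAbs_lt`; Corollary 3.7 ↦ `corollary37`,
  `corollary37_alg36`, `corollary37_sharp`; Theorem 4.3 ↦ `theorem43_le` (first inequality, `≤`),
  `theorem43_lt` (`<` for `S̃ₙ ≠ 0`), `theorem43` (second inequality), `theorem43_dot`,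
  `theorem43_first_lt_fails_at_zero`; (4.8) ↦ `err_le_phi_of_large`; Corollary 4.4 ↦ `corollary44₁`,
  `corollary44₂` (`ϱ = realmin`), `corollary44₁_rho`, `corollary44₂_rho` (`ϱ = 3/2·realmin`),
  `corollary44_dot`; Remark 8 ↦ `isFloat_natCast_add_two`, `isFloat_rho` (`realmin ∈ F` is `Rump2009.isFloat_threshold`).

Reading notes (documented, minor). (i) (2.8) `ufp(r) ≤ ufp(fl(r))` "for `r ∈ ℝ`" fails for
`0 < |r| < eta/2`, where `fl(r) = 0` (`eq28_fails_at_quarter_eta`); it holds whenever `fl(r) ≠ 0`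
([RumpOgitaOishi2008, (2.17)]) and for sums of floats ((2.10), `ufp_add_le_ufp_fl_add`), which is all
the paper uses. (ii) (3.9) `|x| ≤ X, |y| ≤ Y ⟹ |fl(x+y)| ≤ fl(X+Y)` is claimed for every rounding
satisfying (2.1) ("any rounding of the tie"); it is false for a nearest rounding whose tie rule depends
on the sign of the argument (e.g. ties toward −∞: with `X = 1`, `Y = 1−u`, `x = −1`, `y = −(1−u)` one gets
`fl(X+Y) = fl(2−u) = 2−2u < 2 = |fl(−2+u)|`), and then (3.10) `|s̃₂| ≤ S̃₂` fails for `p = (−1, −(1−u))`.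
Both IEEE 754 round-to-nearest modes (ties-to-even, ties-to-away) are sign-symmetric, `fl(−t) = −fl(t)`,
and under that hypothesis (3.9) holds (`mono39`); Theorems 3.5/4.3 and Corollaries 3.7/4.4 are typed
with it. Theorem 3.4 and (3.8) need no tie hypothesis. (iii) In (4.2) the first inequality
`|s̃ₙ − xᵀy| < (n+2)u·ufp(S̃ₙ) + n·eta/2` is an equality when every product rounds to zero from the
midpoint `eta/2` (e.g. `n = 1`, `x₁ = eta`, `y₁ = 1/2` with `fl(eta/2) = 0`, `theorem43_first_lt_fails_at_zero`);
we prove it with `≤`, strict when `S̃ₙ ≠ 0`, and the second inequality `< (n+2)u·ufp(S̃ₙ) + realmin`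
unconditionally (the paper's step "(n−1)u·ufp(S̃ₙ) < ufp(S̃ₙ)" in (4.3) needs `S̃ₙ ≠ 0`). (iv) In
Corollary 4.4 the exactness of `fl((n+2)·u)` (for `R̂`) needs `(n+2)·2^-p ∈ F`, i.e. the format side
condition `emin + p ≤ 0` (`realmin ≤ ½`, every IEEE 754 format); `R̃` needs none. `n + 2 ∈ F`
(Remark 8) is `isFloat_natCast_add_two`.
-/

namespace Literature.ComputerArithmetic.Rump2012

open Literature.ComputerArithmetic.JeannerodRump2018
open Literature.ComputerArithmetic.JeannerodRump2018.SumTree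
open Literature.ComputerArithmetic.BoldoJeannerodMelquiondMuller2023
open Literature.ComputerArithmetic.RumpOgitaOishi2008
open Literature.ComputerArithmetic.Rump2009 (flAcc flAcc_nil flAcc_cons flSum_cons isFloat_flAcc ufpFl
  ufpFl_eq_ufp isFloat_threshold)
open Literature.ComputerArithmetic.RumpOgitaOishi2009 (isFloat_flSum)
open Literature.ComputerArithmetic.JoldesMullerPopescu2017 (isFloat_two_zpow two_zpow_emin_le_abs)
open Literature.ComputerArithmetic.LangeRump2018 (abs_list_sum_le exact_eq_leaves_sum)
open Literature.ComputerArithmetic.JeannerodRump2013 (unitRoundoff_mul_zpow)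
open Literature.ComputerArithmetic.Higham2002 (gamma)

variable {p : ℕ} {emin : ℤ} {fl : ℚ → ℚ}

/-! ### §2: notation, `ufp`, and the rounding facts (2.6)–(2.11) in the form used -/

/-- (2.6) for every real (also `r = 0`): `|r| ≤ 2·ufp(r)`. [cite: Rump2012, §2 eq. (2.6)] -/
theorem abs_le_two_mul_ufp (r : ℚ) : |r| ≤ 2 * ufp r := by
  by_cases hr : r = 0
  · simp [hr, ufp_zero]
  · exact (abs_lt_two_mul_ufp hr).le

/-- Powers of two spelled out: `realmin = 2^(emin+p-1) = eta·2^p/2`. [cite: Rump2012, §2 (u, eta) and Thm 4.3 (realmin)] -/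
theorem two_zpow_emin_add_p_sub_one : (2 : ℚ) ^ (emin + p - 1) = 2 ^ emin * 2 ^ p / 2 := by
  rw [zpow_sub₀ (by norm_num : (2 : ℚ) ≠ 0), zpow_add₀ (by norm_num : (2 : ℚ) ≠ 0), zpow_natCast,
    zpow_one]

/-- `u⁻¹eta = 2^(emin+p) = eta·2^p`. [cite: Rump2012, §2 eq. (2.3)] -/
theorem two_zpow_emin_add_p : (2 : ℚ) ^ (emin + p) = 2 ^ emin * 2 ^ p := by
  rw [zpow_add₀ (by norm_num : (2 : ℚ) ≠ 0), zpow_natCast]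

/-- `u⁻¹realmin = 2^(emin+2p-1) = eta·2^p·2^p/2`. [cite: Rump2012, proof of Cor 4.4 (first case)] -/
theorem two_zpow_emin_add_two_p_sub_one :
    (2 : ℚ) ^ (emin + 2 * p - 1) = 2 ^ emin * 2 ^ p * 2 ^ p / 2 := by
  rw [show emin + 2 * (p : ℤ) - 1 = emin + p + p - 1 by ring, zpow_sub₀ (by norm_num : (2 : ℚ) ≠ 0),
    zpow_add₀ (by norm_num : (2 : ℚ) ≠ 0), zpow_add₀ (by norm_num : (2 : ℚ) ≠ 0), zpow_natCast,
    zpow_one]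

/-- `½u⁻¹realmin = 2^(emin+2p-2) = eta·2^p·2^p/4`. [cite: Rump2012, proof of Cor 4.4 (third case)] -/
theorem two_zpow_emin_add_two_p_sub_two :
    (2 : ℚ) ^ (emin + 2 * p - 2) = 2 ^ emin * 2 ^ p * 2 ^ p / 4 := by
  rw [show emin + 2 * (p : ℤ) - 2 = emin + p + p - 2 by ring, zpow_sub₀ (by norm_num : (2 : ℚ) ≠ 0),
    zpow_add₀ (by norm_num : (2 : ℚ) ≠ 0), zpow_add₀ (by norm_num : (2 : ℚ) ≠ 0), zpow_natCast]
  norm_num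

/-- `u = 1/2^p`, so `u·2^p = 1`. [cite: Rump2012, §2 (u = 2^-53 for binary64)] -/
theorem u_mul_two_pow : unitRoundoff p * (2 : ℚ) ^ p = 1 := by
  rw [unitRoundoff]; field_simp

/-- `c·u ≤ 1 ⟹ c ≤ 2^p = u⁻¹`. [cite: Rump2012, §3 (nu ≤ 1) and Remark 4] -/
theorem le_two_pow_of_mul_u_le_one {c : ℚ} (h : c * unitRoundoff p ≤ 1) : c ≤ (2 : ℚ) ^ p := by
  have := mul_le_mul_of_nonneg_right h (by positivity : (0 : ℚ) ≤ 2 ^ p)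
  rwa [mul_assoc, u_mul_two_pow, mul_one, one_mul] at this

/-- A natural number `N ≤ 2^p` on a dyadic grid `2^e`, `e ≥ emin`, gives the float `N·2^e`
(`(n−1)·2^j`, `(n+2)·2^j`, `n+2` of Corollaries 3.7/4.4 and Remark 8). [cite: Rump2012, Remark 8] -/
theorem isFloat_natCast_mul_two_zpow (hp : 1 ≤ p) {N : ℕ} (hN : (N : ℚ) ≤ 2 ^ p) {e : ℤ}
    (he : emin ≤ e) : IsFloat p emin ((N : ℚ) * (2 : ℚ) ^ e) := by
  refine isFloat_of_onGrid_two_zpow hp ⟨N, by push_cast; ring⟩ ?_ he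
  rw [abs_mul, abs_of_nonneg (by positivity : (0 : ℚ) ≤ N), abs_of_pos (two_zpow_pos e)]
  exact mul_le_mul_of_nonneg_right hN (two_zpow_pos e).le

/-- Remark 8: `fl(n+2) = n+2`, indeed `n + 2 ∈ F` when `(n+2)u ≤ 1` and `emin ≤ 0`.
[cite: Rump2012, Remark 8] -/
theorem isFloat_natCast_add_two (hp : 1 ≤ p) (he : emin ≤ 0) {n : ℕ}
    (hn : ((n : ℚ) + 2) * unitRoundoff p ≤ 1) : IsFloat p emin ((n : ℚ) + 2) := by
  have h := isFloat_natCast_mul_two_zpow (emin := emin) hp (N := n + 2)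
    (by push_cast; exact le_two_pow_of_mul_u_le_one hn) (e := 0) he
  simpa using h

/-- (2.8) SCOPE: for a tiny argument `fl` returns `0` — `|t| ≤ eta/4 ⟹ fl(t) = 0` for EVERY round-to-nearest
(`0` is strictly closer than `±eta`). [cite: Rump2012, §2 eq. (2.8)] -/
theorem fl_eq_zero_of_abs_le_quarter_eta (hfl : IsRoundNearest p emin fl) {t : ℚ}
    (ht : |t| ≤ (2 : ℚ) ^ emin / 4) : fl t = 0 := by
  have h1 : |t - fl t| ≤ |t - 0| := (hfl t).2 0 (isFloat_zero p emin)
  rw [sub_zero] at h1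
  have h2 : |fl t| ≤ (2 : ℚ) ^ emin / 2 := by
    have h3 := abs_sub_abs_le_abs_sub (fl t) t
    rw [abs_sub_comm] at h3
    linarith
  by_contra h0
  have h4 := two_zpow_emin_le_abs (hfl t).1 h0
  linarith [two_zpow_pos emin]

/-- (2.8) SCOPE: `ufp(r) ≤ ufp(fl(r))` needs `fl(r) ≠ 0` — at `r = eta/4 > 0` one has `fl(r) = 0` and
`ufp(fl(r)) = 0 < ufp(r)`; the valid forms are `RumpOgitaOishi2008.ufp_le_ufp_fl` (`fl r ≠ 0`) and
(2.10) `ufp_add_le_ufp_fl_add`. [cite: Rump2012, §2 eq. (2.8)] -/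
theorem eq28_fails_at_quarter_eta (hfl : IsRoundNearest p emin fl) :
    ufp (fl ((2 : ℚ) ^ emin / 4)) < ufp ((2 : ℚ) ^ emin / 4) := by
  rw [fl_eq_zero_of_abs_le_quarter_eta hfl (abs_of_pos (by positivity)).le, ufp_zero]
  exact ufp_pos (by positivity)

/-- (2.9), consequence used in §4: if the ROUNDED value is normal, `realmin ≤ |fl(t)|`, then
`|fl(t) − t| ≤ u·|fl(t)|` (for `|t| ≥ realmin` by `|δ| ≤ u·ufp(t) ≤ u·ufp(fl t) ≤ u|fl t|`, `η = 0`;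
for `|t| < realmin` the error is `≤ eta/2 = u·realmin ≤ u|fl t|`). [cite: Rump2012, §2 eq. (2.9)] -/
theorem abs_fl_sub_le_u_abs_fl_of_le (hp : 1 ≤ p) (hfl : IsRoundNearest p emin fl) {t : ℚ}
    (h : (2 : ℚ) ^ (emin + p - 1) ≤ |fl t|) : |fl t - t| ≤ unitRoundoff p * |fl t| := by
  rcases le_or_gt ((2 : ℚ) ^ (emin + p - 1)) |t| with ht | ht
  · exact Rump2009.abs_fl_sub_le_u_abs_fl hp hfl ht
  · have h1 := JeannerodRump2013.abs_fl_sub_le_half_eta hp hfl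
      (ht.trans (zpow_lt_zpow_right₀ (by norm_num) (by omega)))
    rw [← unitRoundoff_mul_zpow p emin] at h1
    exact h1.trans (mul_le_mul_of_nonneg_left h u_pos.le)

/-- (2.9)/(2.3), consequence used in §4: if `|fl(t)| < u⁻¹eta = 2^(emin+p)` then `|t| < u⁻¹eta` as well
(`2^(emin+p) ∈ F` and monotonicity) and the error is at most half the spacing `eta` there:
`|fl(t) − t| ≤ eta/2`. [cite: Rump2012, §2 eq. (2.9) and (2.3)] -/
theorem abs_fl_sub_le_half_eta_of_abs_fl_lt (hp : 1 ≤ p) (hfl : IsRoundNearest p emin fl) {t : ℚ}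
    (h : |fl t| < (2 : ℚ) ^ (emin + p)) : |fl t - t| ≤ (2 : ℚ) ^ emin / 2 := by
  apply JeannerodRump2013.abs_fl_sub_le_half_eta hp hfl
  have hF : IsFloat p emin ((2 : ℚ) ^ (emin + p)) := isFloat_two_zpow hp (by omega)
  have h1 : t < (2 : ℚ) ^ (emin + p) := lt_of_fl_lt hfl hF (abs_lt.mp h).2
  have h2 : -(2 : ℚ) ^ (emin + p) < t := lt_of_lt_fl hfl hF.neg (abs_lt.mp h).1
  exact abs_lt.mpr ⟨h2, h1⟩

/-- (2.9) as used in the proof of Theorem 4.3: for EVERY real `t`, `|fl(t) − t| ≤ u·|fl(t)| + eta/2`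
(`|p̃ᵢ − pᵢ| ≤ u|p̃ᵢ| + eta/2`). [cite: Rump2012, §2 eq. (2.9) and proof of Thm 4.3] -/
theorem abs_fl_sub_le_u_abs_fl_add (hp : 1 ≤ p) (hfl : IsRoundNearest p emin fl) (t : ℚ) :
    |fl t - t| ≤ unitRoundoff p * |fl t| + (2 : ℚ) ^ emin / 2 := by
  have h0 : 0 ≤ unitRoundoff p * |fl t| := mul_nonneg u_pos.le (abs_nonneg _)
  have h0' : (0 : ℚ) ≤ 2 ^ emin / 2 := by positivity
  rcases le_or_gt ((2 : ℚ) ^ (emin + p - 1)) |fl t| with h | h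
  · linarith [abs_fl_sub_le_u_abs_fl_of_le hp hfl h]
  · have h1 := abs_fl_sub_le_half_eta_of_abs_fl_lt hp hfl
      (h.trans (zpow_lt_zpow_right₀ (by norm_num) (by omega)))
    linarith

/-- (2.9) summed over a vector: for `p̃ᵢ = fl(pᵢ)`, `|Σ p̃ᵢ − Σ pᵢ| ≤ u·Σ|p̃ᵢ| + n·eta/2`.
[cite: Rump2012, proof of Thm 4.3 (display after (4.4))] -/
theorem abs_sum_map_fl_sub_sum_le (hp : 1 ≤ p) (hfl : IsRoundNearest p emin fl) :
    ∀ qs : List ℚ, |(qs.map fl).sum - qs.sum| ≤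
      unitRoundoff p * ((qs.map fl).map abs).sum + (qs.length : ℚ) * ((2 : ℚ) ^ emin / 2)
  | [] => by simp
  | q :: qs => by
      simp only [List.map_cons, List.sum_cons, List.length_cons, Nat.cast_succ]
      have h1 := abs_fl_sub_le_u_abs_fl_add hp hfl q
      have h2 := abs_sum_map_fl_sub_sum_le hp hfl qs
      calc |fl q + (qs.map fl).sum - (q + qs.sum)|
          = |(fl q - q) + ((qs.map fl).sum - qs.sum)| := by ring_nf
        _ ≤ |fl q - q| + |(qs.map fl).sum - qs.sum| := abs_add_le _ _
        _ ≤ _ := by linarith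

/-! ### §3: Lemma 3.3 and Theorem 3.4 (no restriction on `n`, any tie rule) -/

/-- **Lemma 3.3**: for `a ∈ F` and any `b`, `|fl(a + b) − (a + b)| ≤ |b|` (`a` is a rounding candidate; the
source takes `b ∈ F` too and argues via (2.7)/(2.10)). [cite: Rump2012, Lemma 3.3 eq. (3.4)] -/
theorem lemma33 (hfl : IsRoundNearest p emin fl) {a : ℚ} (ha : IsFloat p emin a) (b : ℚ) :
    |fl (a + b) - (a + b)| ≤ |b| :=
  abs_err_le_abs_operand hfl ha b

/-- The induction behind **Theorem 3.4**, peeling one addition at a time (the source's (3.6)–(3.7) with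
its two cases `|pₖ| ≤ u·Σᵢ₍ₖ₎|pᵢ|` — Lemma 3.3 — and `u·Σ|pᵢ| < |pₖ|` — the standard model): if the
accumulator `σ ∈ F` approximates `s₀` with `|σ − s₀| ≤ k·u·A`, `|s₀| ≤ A`, then after accumulating the
floats `x₁ … x_m`, `|flAcc σ x − (s₀ + Σxᵢ)| ≤ (k + m)·u·(A + Σ|xᵢ|)`. [cite: Rump2012, proof of Thm 3.4] -/
theorem theorem34_acc (hp : 1 ≤ p) (hfl : IsRoundNearest p emin fl) :
    ∀ (xs : List ℚ) (σ s₀ A : ℚ) (k : ℕ), (∀ x ∈ xs, IsFloat p emin x) → IsFloat p emin σ →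
      |s₀| ≤ A → |σ - s₀| ≤ (k : ℚ) * unitRoundoff p * A →
      |flAcc fl σ xs - (s₀ + xs.sum)| ≤
        ((k + xs.length : ℕ) : ℚ) * unitRoundoff p * (A + (xs.map abs).sum)
  | [], σ, s₀, A, k, _, _, _, h => by simpa using h
  | x :: xs, σ, s₀, A, k, hxs, hσ, hA, h => by
      have hx : IsFloat p emin x := hxs x (by simp)
      have hxs' : ∀ y ∈ xs, IsFloat p emin y := fun y hy => hxs y (by simp [hy])
      have hu := u_pos (p := p)
      have hA0 : 0 ≤ A := (abs_nonneg _).trans hA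
      have hk0 : (0 : ℚ) ≤ k := by positivity
      have hsplit : |fl (σ + x) - (s₀ + x)| ≤ |fl (σ + x) - (σ + x)| + |σ - s₀| := by
        calc |fl (σ + x) - (s₀ + x)| = |(fl (σ + x) - (σ + x)) + (σ - s₀)| := by ring_nf
          _ ≤ _ := abs_add_le _ _
      have key : |fl (σ + x) - (s₀ + x)| ≤ ((k + 1 : ℕ) : ℚ) * unitRoundoff p * (A + |x|) := by
        push_cast
        rcases le_or_gt |x| (unitRoundoff p * A) with hcase | hcase
        · have h1 := lemma33 hfl hσ x
          have h2 : (0 : ℚ) ≤ (k + 1) * unitRoundoff p * |x| := by positivity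
          nlinarith
        · have h1 : |fl (σ + x) - (σ + x)| ≤ unitRoundoff p * |σ + x| :=
            (abs_fl_add_sub_le_u_ufp hp hfl hσ hx).trans
              (mul_le_mul_of_nonneg_left (ufp_le_abs _) hu.le)
          have h2 : |σ + x| ≤ (k : ℚ) * unitRoundoff p * A + A + |x| := by
            calc |σ + x| = |(σ - s₀) + s₀ + x| := by ring_nf
              _ ≤ |(σ - s₀) + s₀| + |x| := abs_add_le _ _
              _ ≤ |σ - s₀| + |s₀| + |x| := by linarith [abs_add_le (σ - s₀) s₀]
              _ ≤ _ := by linarith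
          have h3 : (k : ℚ) * (unitRoundoff p * A) ≤ (k : ℚ) * |x| :=
            mul_le_mul_of_nonneg_left hcase.le hk0
          have h4 : unitRoundoff p * |σ + x| ≤
              unitRoundoff p * ((k : ℚ) * unitRoundoff p * A + A + |x|) :=
            mul_le_mul_of_nonneg_left h2 hu.le
          nlinarith
      have ih := theorem34_acc hp hfl xs (fl (σ + x)) (s₀ + x) (A + |x|) (k + 1) hxs' (hfl _).1
        ((abs_add_le s₀ x).trans (by linarith)) key
      have e1 : (k + (x :: xs).length : ℕ) = k + 1 + xs.length := by simp; omega
      rw [flAcc_cons, e1, List.sum_cons, List.map_cons, List.sum_cons, ← add_assoc s₀, ← add_assoc A]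
      exact ih

/-- **Theorem 3.4**: for `pᵢ ∈ F` and recursive summation `s̃ₙ = fl(…fl(fl(p₁ + p₂) + p₃)… + pₙ)`
(Algorithm 3.1), `|s̃ₙ − Σ pᵢ| ≤ (n−1)u·Σ|pᵢ|` — NO restriction on `n`, no `O(u²)` term, any tie rule,
gradual underflow included. [cite: Rump2012, Thm 3.4 eq. (3.5)] -/
theorem theorem34 (hp : 1 ≤ p) (hfl : IsRoundNearest p emin fl) {ps : List ℚ}
    (hps : ∀ x ∈ ps, IsFloat p emin x) :
    |flSum fl ps - ps.sum| ≤ ((ps.length : ℚ) - 1) * unitRoundoff p * (ps.map abs).sum := by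
  cases ps with
  | nil => simp [flSum]
  | cons x xs =>
      have hx : IsFloat p emin x := hps x (by simp)
      have hxs : ∀ y ∈ xs, IsFloat p emin y := fun y hy => hps y (by simp [hy])
      have h := theorem34_acc hp hfl xs x x |x| 0 hxs hx le_rfl (by simp)
      rw [flSum_cons, List.sum_cons, List.map_cons, List.sum_cons, List.length_cons]
      have e : (((xs.length + 1 : ℕ) : ℚ) - 1) = ((0 + xs.length : ℕ) : ℚ) := by push_cast; ring
      rw [e]
      exact h

/-- **(3.8)**: with `S̃` a floating-point approximation of `Σ|pᵢ|` by recursive summation IN ANY ORDER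
(any evaluation tree whose leaves are the `|pᵢ|` in some order) and `(n−1)u < 1`,
`|s̃ₙ − Σpᵢ| ≤ γₙ₋₁·S̃` (Theorem 3.4 for `s̃ₙ`; the any-order `(n−1)u` bound for `S̃` is the tree's
`JeannerodRump2018.sumError_le_holds`, hence `p ≥ 2` here). [cite: Rump2012, §3 eq. (3.8)] -/
theorem eq38 (hp : 2 ≤ p) (hfl : IsRoundNearest p emin fl) {ps : List ℚ}
    (hps : ∀ x ∈ ps, IsFloat p emin x) (t : SumTree) (ht : t.leaves.Perm (ps.map abs))
    (hn : ((ps.length - 1 : ℕ) : ℚ) * unitRoundoff p < 1) :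
    |flSum fl ps - ps.sum| ≤ gamma (unitRoundoff p) (ps.length - 1) * t.eval fl := by
  have hu := u_pos (p := p)
  have hn1 : 1 ≤ ps.length := by
    have h1 := one_le_length_leaves t
    rw [ht.length_eq, List.length_map] at h1
    exact h1
  have hleaves : ∀ a ∈ t.leaves, IsFloat p emin a := by
    intro a ha
    obtain ⟨b, hb, rfl⟩ := List.mem_map.mp (ht.mem_iff.mp ha)
    exact isFloat_abs (hps b hb)
  set S : ℚ := (ps.map abs).sum with hSdef
  have hS0 : 0 ≤ S := List.sum_nonneg (by
    intro a ha; obtain ⟨b, -, rfl⟩ := List.mem_map.mp ha; exact abs_nonneg b)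
  have h34 := theorem34 (by omega) hfl hps
  have hcast : ((ps.length : ℚ) - 1) = ((ps.length - 1 : ℕ) : ℚ) := by
    rw [Nat.cast_sub hn1, Nat.cast_one]
  rw [hcast] at h34
  -- the any-order bound for `S̃ = t.eval fl`
  have hJR := sumError_le_holds p emin fl hp hfl t hleaves
  have hlen : t.leaves.length = ps.length := by rw [ht.length_eq, List.length_map]
  have hexact : t.exact = S := by rw [exact_eq_leaves_sum, ht.sum_eq]
  have habs : (t.leaves.map abs).sum = S := by
    rw [(ht.map abs).sum_eq, List.map_map]
    congr 1
    exact List.map_congr_left (fun a _ => by simp)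
  rw [hlen, hexact, habs] at hJR
  have hdiv : unitRoundoff p / (1 + unitRoundoff p) ≤ unitRoundoff p :=
    div_le_self hu.le (by linarith)
  have hm0 : (0 : ℚ) ≤ ((ps.length - 1 : ℕ) : ℚ) := by positivity
  have hJR' : S - t.eval fl ≤ ((ps.length - 1 : ℕ) : ℚ) * unitRoundoff p * S := by
    have h1 : S - t.eval fl ≤ |t.eval fl - S| := by
      rw [abs_sub_comm]; exact le_abs_self _
    have h2 : ((ps.length - 1 : ℕ) : ℚ) * (unitRoundoff p / (1 + unitRoundoff p)) * S ≤
        ((ps.length - 1 : ℕ) : ℚ) * unitRoundoff p * S := by gcongr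
    linarith
  -- `(1 − (n−1)u)·S ≤ S̃`, hence `(n−1)u·S ≤ γₙ₋₁·S̃`
  set m : ℚ := ((ps.length - 1 : ℕ) : ℚ) with hm
  have hpos : 0 < 1 - m * unitRoundoff p := by linarith
  have hSle : S ≤ t.eval fl / (1 - m * unitRoundoff p) := by
    rw [le_div_iff₀ hpos]; nlinarith
  calc |flSum fl ps - ps.sum| ≤ m * unitRoundoff p * S := h34
    _ ≤ m * unitRoundoff p * (t.eval fl / (1 - m * unitRoundoff p)) :=
        mul_le_mul_of_nonneg_left hSle (by positivity)
    _ = gamma (unitRoundoff p) (ps.length - 1) * t.eval fl := by rw [gamma, ← hm]; ring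

/-! ### §3: the monotonicity (3.9)–(3.10) and Theorem 3.5 -/

/-- For a sign-symmetric rounding, `|fl(t)| = fl(|t|)`. [cite: Rump2012, §3 eq. (3.9)] -/
theorem abs_fl_eq_fl_abs (hfl : IsRoundNearest p emin fl) (hsym : ∀ t, fl (-t) = -fl t) (t : ℚ) :
    |fl t| = fl |t| := by
  rcases le_or_gt 0 t with h | h
  · rw [abs_of_nonneg h, abs_of_nonneg (fl_nonneg hfl h)]
  · have hn : 0 ≤ fl (-t) := fl_nonneg hfl (by linarith)
    have h1 : fl t = -fl (-t) := by rw [hsym]; ring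
    rw [abs_of_neg h, h1, abs_neg, abs_of_nonneg hn]

/-- **(3.9)**: `|x| ≤ X`, `|y| ≤ Y ⟹ |fl(x + y)| ≤ fl(X + Y)` for reals `x, y, X, Y` — for a round-to-nearest
with a sign-symmetric tie rule (see the reading note (ii) in the module docstring: false for direction-biased
ties). [cite: Rump2012, §3 eq. (3.9)] -/
theorem mono39 (hfl : IsRoundNearest p emin fl) (hsym : ∀ t, fl (-t) = -fl t) {x y X Y : ℚ}
    (hx : |x| ≤ X) (hy : |y| ≤ Y) : |fl (x + y)| ≤ fl (X + Y) := by
  rw [abs_fl_eq_fl_abs hfl hsym]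
  exact fl_mono hfl ((abs_add_le x y).trans (add_le_add hx hy))

/-- Algorithm 3.2's companion sum: `S̃₁ = |p₁|`, `S̃ₖ = fl(S̃ₖ₋₁ + |pₖ|)` — recursive summation of the
absolute values in the SAME order as `s̃ₖ`. [cite: Rump2012, Algorithm 3.2] -/
def flSumAbs (fl : ℚ → ℚ) (ps : List ℚ) : ℚ := flSum fl (ps.map abs)

/-- `flSumAbs` of the empty vector is `0`. [cite: Rump2012, Algorithm 3.2] -/
@[simp] theorem flSumAbs_nil (fl : ℚ → ℚ) : flSumAbs fl [] = 0 := by simp [flSumAbs, flSum]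

/-- `flSumAbs` unfolded: `S̃ₙ = flAcc |p₁| [|p₂|, …, |pₙ|]`. [cite: Rump2012, Algorithm 3.2] -/
theorem flSumAbs_cons (fl : ℚ → ℚ) (x : ℚ) (xs : List ℚ) :
    flSumAbs fl (x :: xs) = flAcc fl |x| (xs.map abs) := by
  rw [flSumAbs, List.map_cons, flSum_cons]

/-- Taking absolute values twice changes nothing: `S̃` of `(|p̃ᵢ|)` is `S̃` of `(p̃ᵢ)` ((4.3)).
[cite: Rump2012, proof of Thm 4.3 eq. (4.3)] -/
theorem flSumAbs_map_abs (fl : ℚ → ℚ) (l : List ℚ) : flSumAbs fl (l.map abs) = flSumAbs fl l := by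
  unfold flSumAbs
  rw [List.map_map]
  congr 1
  exact List.map_congr_left (fun a _ => by simp)

/-- (3.10) along the accumulation: `|σ| ≤ Σ ⟹ |flAcc σ x| ≤ flAcc Σ |x|`. [cite: Rump2012, §3 eq. (3.10)] -/
theorem abs_flAcc_le (hfl : IsRoundNearest p emin fl) (hsym : ∀ t, fl (-t) = -fl t) :
    ∀ (xs : List ℚ) {σ S : ℚ}, |σ| ≤ S → |flAcc fl σ xs| ≤ flAcc fl S (xs.map abs)
  | [], _, _, h => by simpa using h
  | x :: xs, σ, S, h => by
      rw [flAcc_cons, List.map_cons, flAcc_cons]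
      exact abs_flAcc_le hfl hsym xs (mono39 hfl hsym h le_rfl)

/-- **(3.10)**: `|s̃ₖ| ≤ S̃ₖ` for the quantities of Algorithm 3.2 (no hypothesis on the `pᵢ`).
[cite: Rump2012, §3 eq. (3.10)] -/
theorem eq310 (hfl : IsRoundNearest p emin fl) (hsym : ∀ t, fl (-t) = -fl t) (ps : List ℚ) :
    |flSum fl ps| ≤ flSumAbs fl ps := by
  cases ps with
  | nil => simp [flSum]
  | cons x xs =>
      rw [flSumAbs_cons, flSum_cons]
      exact abs_flAcc_le hfl hsym xs le_rfl

/-- Accumulating nonnegative terms onto a float never decreases it (`fl(a + b) ≥ a` for `a ∈ F`, `b ≥ 0`):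
`Σ ≤ flAcc Σ y`. [cite: Rump2012, proof of Cor 4.4 ("fl(a+b) ≥ a for nonnegative a, b ∈ F")] -/
theorem le_flAcc_of_nonneg (hfl : IsRoundNearest p emin fl) :
    ∀ (ys : List ℚ) {S : ℚ}, IsFloat p emin S → (∀ y ∈ ys, 0 ≤ y) → S ≤ flAcc fl S ys
  | [], _, _, _ => by simp
  | y :: ys, S, hS, hys => by
      rw [flAcc_cons]
      have h1 : S ≤ fl (S + y) := le_fl_of_le hfl hS (by linarith [hys y (by simp)])
      exact h1.trans (le_flAcc_of_nonneg hfl ys (hfl _).1 (fun z hz => hys z (by simp [hz])))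

/-- Every accumulated nonnegative float is below the final accumulation: `yᵢ ≤ flAcc Σ y` (`Σ ∈ F`, `Σ ≥ 0`,
`yᵢ ∈ F`). [cite: Rump2012, proof of Cor 4.4 (second case)] -/
theorem le_flAcc_of_mem (hfl : IsRoundNearest p emin fl) :
    ∀ (ys : List ℚ) {S : ℚ}, IsFloat p emin S → 0 ≤ S → (∀ y ∈ ys, IsFloat p emin y ∧ 0 ≤ y) →
      ∀ y ∈ ys, y ≤ flAcc fl S ys
  | [], _, _, _, _, y, hy => by simp at hy
  | z :: ys, S, hS, hS0, hys, y, hy => by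
      rw [flAcc_cons]
      have hz := hys z (by simp)
      have hys' : ∀ w ∈ ys, IsFloat p emin w ∧ 0 ≤ w := fun w hw => hys w (by simp [hw])
      have hS' : 0 ≤ fl (S + z) := fl_nonneg hfl (by linarith [hz.2])
      rcases List.mem_cons.mp hy with rfl | hy
      · have h1 : y ≤ fl (S + y) := le_fl_of_le hfl hz.1 (by linarith)
        exact h1.trans (le_flAcc_of_nonneg hfl ys (hfl _).1 (fun w hw => (hys' w hw).2))
      · exact le_flAcc_of_mem hfl ys (hfl _).1 hS' hys' y hy

/-- `S̃ₙ ≥ 0` for floats `pᵢ`. [cite: Rump2012, §3 ("|S̃ₙ| = S̃ₙ")] -/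
theorem flSumAbs_nonneg (hfl : IsRoundNearest p emin fl) {ps : List ℚ}
    (hps : ∀ x ∈ ps, IsFloat p emin x) : 0 ≤ flSumAbs fl ps := by
  cases ps with
  | nil => simp
  | cons x xs =>
      rw [flSumAbs_cons]
      exact (abs_nonneg x).trans (le_flAcc_of_nonneg hfl _ (isFloat_abs (hps x (by simp)))
        (by intro y hy; obtain ⟨z, -, rfl⟩ := List.mem_map.mp hy; exact abs_nonneg z))

/-- `|p̃ᵢ| ≤ S̃ₙ` for floats `p̃ᵢ`. [cite: Rump2012, proof of Cor 4.4 (second case)] -/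
theorem abs_le_flSumAbs (hfl : IsRoundNearest p emin fl) {ps : List ℚ}
    (hps : ∀ x ∈ ps, IsFloat p emin x) : ∀ x ∈ ps, |x| ≤ flSumAbs fl ps := by
  cases ps with
  | nil => simp
  | cons y ys =>
      intro x hx
      rw [flSumAbs_cons]
      have hy : IsFloat p emin |y| := isFloat_abs (hps y (by simp))
      have hys : ∀ w ∈ ys.map abs, IsFloat p emin w ∧ 0 ≤ w := by
        intro w hw; obtain ⟨z, hz, rfl⟩ := List.mem_map.mp hw
        exact ⟨isFloat_abs (hps z (by simp [hz])), abs_nonneg z⟩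
      rcases List.mem_cons.mp hx with rfl | hx
      · exact le_flAcc_of_nonneg hfl _ hy (fun w hw => (hys w hw).2)
      · exact le_flAcc_of_mem hfl _ hy (abs_nonneg y) hys |x| (List.mem_map.mpr ⟨x, hx, rfl⟩)

/-- `S̃` and `s̃` are floats. [cite: Rump2012, Algorithm 3.2] -/
theorem isFloat_flSumAbs (hfl : IsRoundNearest p emin fl) {ps : List ℚ}
    (hps : ∀ x ∈ ps, IsFloat p emin x) : IsFloat p emin (flSumAbs fl ps) :=
  isFloat_flSum hfl (by intro w hw; obtain ⟨z, hz, rfl⟩ := List.mem_map.mp hw; exact isFloat_abs (hps z hz))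

/-- The induction behind **Theorem 3.5** ((2.9) + (3.10): `|s̃ₖ − sₖ| ≤ u·ufp(s̃ₖ) ≤ u·ufp(S̃ₖ)` and
`ufp(S̃ₖ₋₁) ≤ ufp(S̃ₖ)`): if `σ, Σ ∈ F`, `|σ| ≤ Σ`, `|σ − s₀| ≤ k·u·ufp(Σ)`, then after accumulating floats
`x₁ … x_m` on `σ` and `|x₁| … |x_m|` on `Σ`, `|flAcc σ x − (s₀ + Σxᵢ)| ≤ (k + m)·u·ufp(flAcc Σ |x|)`.
[cite: Rump2012, proof of Thm 3.5] -/
theorem theorem35_acc (hp : 1 ≤ p) (hfl : IsRoundNearest p emin fl) (hsym : ∀ t, fl (-t) = -fl t) :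
    ∀ (xs : List ℚ) (σ S s₀ : ℚ) (k : ℕ), (∀ x ∈ xs, IsFloat p emin x) → IsFloat p emin σ →
      IsFloat p emin S → |σ| ≤ S → |σ - s₀| ≤ (k : ℚ) * unitRoundoff p * ufp S →
      |flAcc fl σ xs - (s₀ + xs.sum)| ≤
        ((k + xs.length : ℕ) : ℚ) * unitRoundoff p * ufp (flAcc fl S (xs.map abs))
  | [], σ, S, s₀, k, _, _, _, _, h => by simpa using h
  | x :: xs, σ, S, s₀, k, hxs, hσ, hS, hle, h => by
      have hx : IsFloat p emin x := hxs x (by simp)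
      have hxs' : ∀ y ∈ xs, IsFloat p emin y := fun y hy => hxs y (by simp [hy])
      have hu := u_pos (p := p)
      have hS0 : 0 ≤ S := (abs_nonneg σ).trans hle
      have hσ'S' : |fl (σ + x)| ≤ fl (S + |x|) := mono39 hfl hsym hle le_rfl
      have hS'0 : 0 ≤ fl (S + |x|) := (abs_nonneg _).trans hσ'S'
      have hSS' : S ≤ fl (S + |x|) := le_fl_of_le hfl hS (by linarith [abs_nonneg x])
      have hufp1 : ufp S ≤ ufp (fl (S + |x|)) :=
        ufp_mono (by rw [abs_of_nonneg hS0, abs_of_nonneg hS'0]; exact hSS')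
      have hδ : |fl (σ + x) - (σ + x)| ≤ unitRoundoff p * ufp (fl (S + |x|)) := by
        have h1 := abs_fl_add_sub_le_u_ufp hp hfl hσ hx
        have h2 := ufp_add_le_ufp_fl_add hp hfl hσ hx
        have h3 : ufp (fl (σ + x)) ≤ ufp (fl (S + |x|)) :=
          ufp_mono (by rw [abs_of_nonneg hS'0]; exact hσ'S')
        exact h1.trans (mul_le_mul_of_nonneg_left (h2.trans h3) hu.le)
      have key : |fl (σ + x) - (s₀ + x)| ≤
          ((k + 1 : ℕ) : ℚ) * unitRoundoff p * ufp (fl (S + |x|)) := by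
        have hk0 : (0 : ℚ) ≤ (k : ℚ) * unitRoundoff p := by positivity
        calc |fl (σ + x) - (s₀ + x)| = |(fl (σ + x) - (σ + x)) + (σ - s₀)| := by ring_nf
          _ ≤ |fl (σ + x) - (σ + x)| + |σ - s₀| := abs_add_le _ _
          _ ≤ unitRoundoff p * ufp (fl (S + |x|)) + (k : ℚ) * unitRoundoff p * ufp S :=
              add_le_add hδ h
          _ ≤ unitRoundoff p * ufp (fl (S + |x|)) +
                (k : ℚ) * unitRoundoff p * ufp (fl (S + |x|)) := by
              gcongr
          _ = ((k + 1 : ℕ) : ℚ) * unitRoundoff p * ufp (fl (S + |x|)) := by push_cast; ring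
      have ih := theorem35_acc hp hfl hsym xs (fl (σ + x)) (fl (S + |x|)) (s₀ + x) (k + 1) hxs'
        (hfl _).1 (hfl _).1 hσ'S' key
      have e1 : (k + (x :: xs).length : ℕ) = k + 1 + xs.length := by simp; omega
      rw [flAcc_cons, List.map_cons, flAcc_cons, e1, List.sum_cons, ← add_assoc s₀]
      exact ih

/-- **Theorem 3.5**: for `pᵢ ∈ F` and the quantities `s̃ₙ`, `S̃ₙ` of Algorithm 3.2 (same order of
summation), `|s̃ₙ − Σpᵢ| ≤ (n−1)u·ufp(S̃ₙ)` — no restriction on `n`; sign-symmetric tie rule.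
[cite: Rump2012, Thm 3.5 eq. (3.11)] -/
theorem theorem35 (hp : 1 ≤ p) (hfl : IsRoundNearest p emin fl) (hsym : ∀ t, fl (-t) = -fl t)
    {ps : List ℚ} (hps : ∀ x ∈ ps, IsFloat p emin x) :
    |flSum fl ps - ps.sum| ≤ ((ps.length : ℚ) - 1) * unitRoundoff p * ufp (flSumAbs fl ps) := by
  cases ps with
  | nil => simp [flSum, ufp_zero]
  | cons x xs =>
      have hx : IsFloat p emin x := hps x (by simp)
      have hxs : ∀ y ∈ xs, IsFloat p emin y := fun y hy => hps y (by simp [hy])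
      have h := theorem35_acc hp hfl hsym xs x |x| x 0 hxs hx (isFloat_abs hx) le_rfl
        (by simp)
      rw [flSumAbs_cons, flSum_cons, List.sum_cons, List.length_cons]
      have e : (((xs.length + 1 : ℕ) : ℚ) - 1) = ((0 + xs.length : ℕ) : ℚ) := by push_cast; ring
      rw [e]
      exact h

/-- **Theorem 3.5**, the weaker form in brackets: `|s̃ₙ − Σpᵢ| ≤ (n−1)u·S̃ₙ`.
[cite: Rump2012, Thm 3.5 eq. (3.11)] -/
theorem theorem35' (hp : 1 ≤ p) (hfl : IsRoundNearest p emin fl) (hsym : ∀ t, fl (-t) = -fl t)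
    {ps : List ℚ} (hps : ∀ x ∈ ps, IsFloat p emin x) :
    |flSum fl ps - ps.sum| ≤ ((ps.length : ℚ) - 1) * unitRoundoff p * flSumAbs fl ps := by
  cases ps with
  | nil => simp [flSum]
  | cons x xs =>
      refine (theorem35 hp hfl hsym hps).trans (mul_le_mul_of_nonneg_left ?_ ?_)
      · have h := ufp_le_abs (flSumAbs fl (x :: xs))
        rwa [abs_of_nonneg (flSumAbs_nonneg hfl hps)] at h
      · have : (0 : ℚ) ≤ ((x :: xs).length : ℚ) - 1 := by simp
        exact mul_nonneg this u_pos.le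

/-- **Theorem 3.5 is sharp for every `n`**: with `p₁ = 1`, `pᵢ = u` (`i ≥ 2`) and a rounding with
`fl(1 + u) = 1` (the midpoint of `1` and `1 + 2u`; IEEE 754 ties-to-even rounds it to `1`), one gets
`s̃ₙ = S̃ₙ = 1` and `|s̃ₙ − Σpᵢ| = (n−1)u = (n−1)u·ufp(S̃ₙ)` (`pᵢ ∈ F` when `emin + p ≤ 0`).
[cite: Rump2012, proof of Thm 3.5 (sharpness)] -/
theorem theorem35_sharp (htie : fl (1 + unitRoundoff p) = 1) (m : ℕ) :
    flSum fl (1 :: List.replicate m (unitRoundoff p)) = 1 ∧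
    flSumAbs fl (1 :: List.replicate m (unitRoundoff p)) = 1 ∧
    |flSum fl (1 :: List.replicate m (unitRoundoff p)) - (1 :: List.replicate m (unitRoundoff p)).sum|
      = (((1 :: List.replicate m (unitRoundoff p)).length : ℚ) - 1) * unitRoundoff p *
          ufp (flSumAbs fl (1 :: List.replicate m (unitRoundoff p))) := by
  have hu := u_pos (p := p)
  have hacc : ∀ k : ℕ, flAcc fl 1 (List.replicate k (unitRoundoff p)) = 1 := by
    intro k
    induction k with
    | zero => simp
    | succ k ih => rw [List.replicate_succ, flAcc_cons, htie, ih]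
  have h1 : flSum fl (1 :: List.replicate m (unitRoundoff p)) = 1 := by rw [flSum_cons, hacc]
  have h2 : flSumAbs fl (1 :: List.replicate m (unitRoundoff p)) = 1 := by
    rw [flSumAbs_cons, List.map_replicate, abs_of_pos hu, abs_one, hacc]
  have hufp1 : ufp (1 : ℚ) = 1 := by have := ufp_two_zpow (0 : ℤ); simpa using this
  refine ⟨h1, h2, ?_⟩
  rw [h1, h2, hufp1, List.sum_cons, List.sum_replicate, nsmul_eq_mul, List.length_cons,
    List.length_replicate]
  push_cast
  rw [show |(1 : ℚ) - (1 + m * unitRoundoff p)| = m * unitRoundoff p by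
    rw [show (1 : ℚ) - (1 + m * unitRoundoff p) = -(m * unitRoundoff p) by ring, abs_neg,
      abs_of_nonneg (by positivity)]]
  ring

/-- (2.3) for Algorithm 3.2: if the final `S̃ₙ < u⁻¹eta` then NO rounding error occurred at all — along the
accumulation: `|σ| ≤ Σ`, `flAcc Σ |x| < 2^(emin+p)` ⟹ `flAcc σ x = σ + Σxᵢ` and `flAcc Σ |x| = Σ + Σ|xᵢ|`
(by (3.10) every partial sum is below `u⁻¹eta`, where additions of floats are exact).
[cite: Rump2012, proof of Cor 3.7 ("no rounding error at all")] -/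
theorem flAcc_exact_of_lt (hp : 1 ≤ p) (hfl : IsRoundNearest p emin fl) (hsym : ∀ t, fl (-t) = -fl t) :
    ∀ (xs : List ℚ) (σ S : ℚ), (∀ x ∈ xs, IsFloat p emin x) → IsFloat p emin σ → IsFloat p emin S →
      |σ| ≤ S → flAcc fl S (xs.map abs) < (2 : ℚ) ^ (emin + p) →
      flAcc fl σ xs = σ + xs.sum ∧ flAcc fl S (xs.map abs) = S + (xs.map abs).sum
  | [], σ, S, _, _, _, _, _ => by simp
  | x :: xs, σ, S, hxs, hσ, hS, hle, hlt => by
      have hx : IsFloat p emin x := hxs x (by simp)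
      have hxs' : ∀ y ∈ xs, IsFloat p emin y := fun y hy => hxs y (by simp [hy])
      have hS0 : 0 ≤ S := (abs_nonneg σ).trans hle
      rw [List.map_cons, flAcc_cons] at hlt
      have hσ'S' : |fl (σ + x)| ≤ fl (S + |x|) := mono39 hfl hsym hle le_rfl
      have hgrow : fl (S + |x|) ≤ flAcc fl (fl (S + |x|)) (xs.map abs) :=
        le_flAcc_of_nonneg hfl _ (hfl _).1
          (by intro y hy; obtain ⟨z, -, rfl⟩ := List.mem_map.mp hy; exact abs_nonneg z)
      have hS'lt : fl (S + |x|) < (2 : ℚ) ^ (emin + p) := hgrow.trans_lt hlt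
      have hgrid : ∀ {f : ℚ}, IsFloat p emin f →
          OnGrid (unitRoundoff p * (2 : ℚ) ^ (emin + (p : ℤ))) f := by
        intro f hf
        rw [u_mul_two_zpow, show emin + (p : ℤ) - p = emin by ring]
        exact onGrid_eta_of_isFloat hf
      have e1 : fl (σ + x) = σ + x :=
        fl_add_eq_add_of_abs_fl_lt hp hfl hσ hx (hgrid hσ) (hgrid hx) (hσ'S'.trans_lt hS'lt)
      have e2 : fl (S + |x|) = S + |x| :=
        fl_add_eq_add_of_abs_fl_lt hp hfl hS (isFloat_abs hx) (hgrid hS) (hgrid (isFloat_abs hx))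
          (by rw [abs_of_nonneg (fl_nonneg hfl (by positivity))]; exact hS'lt)
      obtain ⟨ih1, ih2⟩ := flAcc_exact_of_lt hp hfl hsym xs (fl (σ + x)) (fl (S + |x|)) hxs'
        (hfl _).1 (hfl _).1 hσ'S' hlt
      rw [flAcc_cons, List.map_cons, flAcc_cons, ih1, ih2, e1, e2, List.sum_cons, List.sum_cons]
      constructor <;> ring

/-- (2.3) for Algorithm 3.2, vector form: `S̃ₙ < u⁻¹eta ⟹ s̃ₙ = Σpᵢ` and `S̃ₙ = Σ|pᵢ|` exactly.
[cite: Rump2012, proof of Cor 3.7 and proof of Cor 4.4 (second case)] -/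
theorem flSum_exact_of_flSumAbs_lt (hp : 1 ≤ p) (hfl : IsRoundNearest p emin fl)
    (hsym : ∀ t, fl (-t) = -fl t) {ps : List ℚ} (hps : ∀ x ∈ ps, IsFloat p emin x)
    (h : flSumAbs fl ps < (2 : ℚ) ^ (emin + p)) :
    flSum fl ps = ps.sum ∧ flSumAbs fl ps = (ps.map abs).sum := by
  cases ps with
  | nil => simp [flSum]
  | cons x xs =>
      have hx : IsFloat p emin x := hps x (by simp)
      have hxs : ∀ y ∈ xs, IsFloat p emin y := fun y hy => hps y (by simp [hy])
      rw [flSumAbs_cons] at h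
      obtain ⟨h1, h2⟩ := flAcc_exact_of_lt hp hfl hsym xs x |x| hxs hx (isFloat_abs hx) le_rfl h
      rw [flSumAbs_cons, flSum_cons, h1, h2, List.sum_cons, List.map_cons, List.sum_cons]
      exact ⟨rfl, rfl⟩

/-! ### §3: Algorithm 3.6 and Corollary 3.7 — the bound computable in rounding to nearest -/

/-- The floating-point bound of (3.12): `R̃ = fl((n−1)·fl(u·r))` with `r = ufp(S̃ₙ)` (computed by
Algorithm 3.6 = `Rump2009.ufpFl`). [cite: Rump2012, Cor 3.7 eq. (3.12)] -/
def sumErrBound (fl : ℚ → ℚ) (p n : ℕ) (r : ℚ) : ℚ :=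
  fl (((n : ℚ) - 1) * fl (unitRoundoff p * r))

/-- **Corollary 3.7**: `pᵢ ∈ F`, `nu ≤ 1`, `r = ufp(S̃ₙ)` ⟹ `|s̃ₙ − Σpᵢ| ≤ fl((n−1)·fl(u·r))` — if
`S̃ₙ < u⁻¹eta` there is no rounding error at all (and the bound is `≥ 0`); otherwise `u·r` and `(n−1)·u·r`
are floats, the bound is computed exactly, and Theorem 3.5 applies. Sign-symmetric tie rule.
[cite: Rump2012, Cor 3.7 eq. (3.12)] -/
theorem corollary37 (hp : 1 ≤ p) (hfl : IsRoundNearest p emin fl) (hsym : ∀ t, fl (-t) = -fl t)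
    {ps : List ℚ} (hps : ∀ x ∈ ps, IsFloat p emin x) (hn : (ps.length : ℚ) * unitRoundoff p ≤ 1) :
    |flSum fl ps - ps.sum| ≤ sumErrBound fl p ps.length (ufp (flSumAbs fl ps)) := by
  have hu := u_pos (p := p)
  rcases lt_or_ge (flSumAbs fl ps) ((2 : ℚ) ^ (emin + p)) with hlt | hge
  · obtain ⟨h1, -⟩ := flSum_exact_of_flSumAbs_lt hp hfl hsym hps hlt
    rw [h1, sub_self, abs_zero, sumErrBound]
    cases ps with
    | nil => simp [ufp_zero, fl_zero hfl]
    | cons x xs =>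
        refine fl_nonneg hfl (mul_nonneg (by simp) (fl_nonneg hfl (mul_nonneg hu.le (ufp_nonneg _))))
  · have hS0 : flSumAbs fl ps ≠ 0 := by
      intro h0; rw [h0] at hge; exact absurd hge (not_le.mpr (two_zpow_pos _))
    have hn1 : 1 ≤ ps.length := by
      cases ps with
      | nil => exact absurd (flSumAbs_nil fl) hS0
      | cons x xs => simp
    obtain ⟨K, hK⟩ := exists_ufp_eq_two_zpow hS0
    have hKge : emin + p ≤ K := by
      have h1 : (2 : ℚ) ^ (emin + p) ≤ ufp (flSumAbs fl ps) :=
        two_zpow_le_ufp (by rwa [abs_of_nonneg (flSumAbs_nonneg hfl hps)])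
      rw [hK] at h1
      exact (zpow_le_zpow_iff_right₀ (by norm_num : (1 : ℚ) < 2)).mp h1
    have e_ur : fl (unitRoundoff p * ufp (flSumAbs fl ps)) = (2 : ℚ) ^ (K - p) := by
      rw [hK, u_mul_two_zpow]; exact fl_eq_self hfl (isFloat_two_zpow hp (by omega))
    have hcast : ((ps.length : ℚ) - 1) = ((ps.length - 1 : ℕ) : ℚ) := by
      rw [Nat.cast_sub hn1, Nat.cast_one]
    have hNF : IsFloat p emin (((ps.length : ℚ) - 1) * (2 : ℚ) ^ (K - p)) := by
      rw [hcast]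
      refine isFloat_natCast_mul_two_zpow hp ?_ (by omega)
      rw [← hcast]
      linarith [le_two_pow_of_mul_u_le_one hn]
    rw [sumErrBound, e_ur, fl_eq_self hfl hNF]
    have h35 := theorem35 hp hfl hsym hps
    rw [hK, mul_assoc, u_mul_two_zpow] at h35
    exact h35

/-- **Corollary 3.7 with Algorithm 3.6**: the same with `r` COMPUTED by Algorithm 3.6
(`Rump2009.ufpFl`, four floating-point operations in rounding to nearest, exact for every float argument,
`p ≥ 2`). [cite: Rump2012, Algorithm 3.6 and Cor 3.7] -/
theorem corollary37_alg36 (hp : 2 ≤ p) (hfl : IsRoundNearest p emin fl) (hsym : ∀ t, fl (-t) = -fl t)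
    {ps : List ℚ} (hps : ∀ x ∈ ps, IsFloat p emin x) (hn : (ps.length : ℚ) * unitRoundoff p ≤ 1) :
    |flSum fl ps - ps.sum| ≤ sumErrBound fl p ps.length (ufpFl fl p (flSumAbs fl ps)) := by
  rw [ufpFl_eq_ufp hp hfl (isFloat_flSumAbs hfl hps)]
  exact corollary37 (by omega) hfl hsym hps hn

/-- **Corollary 3.7 is sharp for `n ≤ u⁻¹`**: with the data of `theorem35_sharp` (`p₁ = 1`, `pᵢ = u`,
`fl(1 + u) = 1`), `n = m + 1 ≤ 2^p` and `emin + p ≤ 0` (so that `u ∈ F`), the computed bound is EXACTLY the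
error `(n−1)u`. [cite: Rump2012, Cor 3.7 ("sharp for all n ≤ u⁻¹")] -/
theorem corollary37_sharp (hp : 1 ≤ p) (he : emin + p ≤ 0) (hfl : IsRoundNearest p emin fl)
    (htie : fl (1 + unitRoundoff p) = 1) {m : ℕ} (hm : (m : ℚ) + 1 ≤ 2 ^ p) :
    sumErrBound fl p (1 :: List.replicate m (unitRoundoff p)).length
        (ufp (flSumAbs fl (1 :: List.replicate m (unitRoundoff p)))) = m * unitRoundoff p ∧
    |flSum fl (1 :: List.replicate m (unitRoundoff p)) - (1 :: List.replicate m (unitRoundoff p)).sum|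
      = m * unitRoundoff p := by
  obtain ⟨h1, h2, h3⟩ := theorem35_sharp htie m
  have hufp1 : ufp (1 : ℚ) = 1 := by have := ufp_two_zpow (0 : ℤ); simpa using this
  have huF : IsFloat p emin (unitRoundoff p) := by
    have := isFloat_two_zpow (p := p) (emin := emin) hp (k := -(p : ℤ)) (by omega)
    rw [unitRoundoff, one_div, ← zpow_natCast, ← zpow_neg]; exact this
  have hmuF : IsFloat p emin ((m : ℚ) * unitRoundoff p) := by
    have := isFloat_natCast_mul_two_zpow (emin := emin) hp (N := m) (by linarith) (e := -(p : ℤ))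
      (by omega)
    rw [unitRoundoff, one_div, ← zpow_natCast, ← zpow_neg]; exact this
  have hR : sumErrBound fl p (1 :: List.replicate m (unitRoundoff p)).length
      (ufp (flSumAbs fl (1 :: List.replicate m (unitRoundoff p)))) = m * unitRoundoff p := by
    rw [sumErrBound, h2, hufp1, mul_one, fl_eq_self hfl huF, List.length_cons, List.length_replicate]
    push_cast
    rw [show ((m : ℚ) + 1 - 1) = m by ring, fl_eq_self hfl hmuF]
  refine ⟨hR, ?_⟩
  rw [h3, h2, hufp1, List.length_cons, List.length_replicate]
  push_cast
  ring

/-! ### §4: dot products — Theorem 4.3 -/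

/-- Algorithm 4.1/4.2, the rounded products `p̃ᵢ = fl(xᵢ·yᵢ)`. [cite: Rump2012, Algorithms 4.1–4.2] -/
def flProducts (fl : ℚ → ℚ) (xs ys : List ℚ) : List ℚ := (List.zipWith (· * ·) xs ys).map fl

/-- Algorithm 4.1: `s̃ₙ`, recursive summation of the rounded products. [cite: Rump2012, Algorithm 4.1] -/
def flDot (fl : ℚ → ℚ) (xs ys : List ℚ) : ℚ := flSum fl (flProducts fl xs ys)

/-- Algorithm 4.2: `S̃ₙ`, recursive summation of `|p̃ᵢ|` in the same order. [cite: Rump2012, Algorithm 4.2] -/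
def flDotAbs (fl : ℚ → ℚ) (xs ys : List ℚ) : ℚ := flSumAbs fl (flProducts fl xs ys)

/-- (4.3): `Σ|p̃ᵢ| ≤ S̃ₙ + (n−1)u·ufp(S̃ₙ)` (Theorem 3.5 applied to `(|p̃ᵢ|)`, whose companion sum is again
`S̃ₙ`). [cite: Rump2012, proof of Thm 4.3 eq. (4.3)] -/
theorem sum_abs_le_flSumAbs_add (hp : 1 ≤ p) (hfl : IsRoundNearest p emin fl)
    (hsym : ∀ t, fl (-t) = -fl t) {l : List ℚ} (hl : ∀ x ∈ l, IsFloat p emin x) :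
    (l.map abs).sum ≤
      flSumAbs fl l + ((l.length : ℚ) - 1) * unitRoundoff p * ufp (flSumAbs fl l) := by
  have h := theorem35 hp hfl hsym (ps := l.map abs)
    (by intro w hw; obtain ⟨z, hz, rfl⟩ := List.mem_map.mp hw; exact isFloat_abs (hl z hz))
  rw [flSumAbs_map_abs, List.length_map] at h
  change |flSumAbs fl l - (l.map abs).sum| ≤ _ at h
  linarith [(abs_le.mp h).1]

/-- `1 ≤ p` from a hypothesis `c·u ≤ 1` with `c ≥ 2` (e.g. `(n+2)u ≤ 1`). [cite: Rump2012, Thm 4.3 ((n+2)u ≤ 1)] -/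
theorem one_le_prec_of_mul_u_le_one {c : ℚ} (hc : 2 ≤ c) (h : c * unitRoundoff p ≤ 1) : 1 ≤ p := by
  have h2 : (2 : ℚ) ≤ 2 ^ p := hc.trans (le_two_pow_of_mul_u_le_one h)
  by_contra h0
  have : p = 0 := by omega
  rw [this] at h2; norm_num at h2

/-- **Theorem 4.3, first inequality** (with `≤`, see reading note (iii)): for ANY rationals `p₁ … pₙ`
(e.g. `pᵢ = xᵢyᵢ`), `p̃ᵢ = fl(pᵢ)`, `s̃ₙ`, `S̃ₙ` by Algorithm 4.2 and `(n−1)u ≤ 1`: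
`|s̃ₙ − Σpᵢ| ≤ (n+2)u·ufp(S̃ₙ) + n·eta/2`. Sign-symmetric tie rule. [cite: Rump2012, Thm 4.3 eq. (4.2)] -/
theorem theorem43_le (hp : 1 ≤ p) (hfl : IsRoundNearest p emin fl) (hsym : ∀ t, fl (-t) = -fl t)
    (qs : List ℚ) (hn : ((qs.length : ℚ) - 1) * unitRoundoff p ≤ 1) :
    |flSum fl (qs.map fl) - qs.sum| ≤
      ((qs.length : ℚ) + 2) * unitRoundoff p * ufp (flSumAbs fl (qs.map fl)) +
        (qs.length : ℚ) * ((2 : ℚ) ^ emin / 2) := by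
  have hu := u_pos (p := p)
  have hptF : ∀ x ∈ qs.map fl, IsFloat p emin x := by
    intro x hx; obtain ⟨q, -, rfl⟩ := List.mem_map.mp hx; exact (hfl q).1
  have h35 := theorem35 hp hfl hsym hptF
  have hsa := sum_abs_le_flSumAbs_add hp hfl hsym hptF
  have hrd := abs_sum_map_fl_sub_sum_le hp hfl qs
  rw [List.length_map] at h35 hsa
  set S := flSumAbs fl (qs.map fl) with hSdef
  set r := ufp S with hrdef
  have hr0 : 0 ≤ r := ufp_nonneg _
  have hS2r : S ≤ 2 * r := (le_abs_self S).trans (abs_le_two_mul_ufp S)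
  have h1 : unitRoundoff p * ((qs.map fl).map abs).sum ≤
      unitRoundoff p * (S + ((qs.length : ℚ) - 1) * unitRoundoff p * r) :=
    mul_le_mul_of_nonneg_left hsa hu.le
  have h2 : ((qs.length : ℚ) - 1) * unitRoundoff p * (unitRoundoff p * r) ≤ 1 * (unitRoundoff p * r) :=
    mul_le_mul_of_nonneg_right hn (by positivity)
  calc |flSum fl (qs.map fl) - qs.sum|
      = |(flSum fl (qs.map fl) - (qs.map fl).sum) + ((qs.map fl).sum - qs.sum)| := by ring_nf
    _ ≤ |flSum fl (qs.map fl) - (qs.map fl).sum| + |(qs.map fl).sum - qs.sum| := abs_add_le _ _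
    _ ≤ ((qs.length : ℚ) - 1) * unitRoundoff p * r +
          (unitRoundoff p * ((qs.map fl).map abs).sum + (qs.length : ℚ) * ((2 : ℚ) ^ emin / 2)) :=
        add_le_add h35 hrd
    _ ≤ _ := by nlinarith [mul_le_mul_of_nonneg_left hS2r hu.le]

/-- **Theorem 4.3, first inequality, strict** as printed, valid as soon as `S̃ₙ ≠ 0`.
[cite: Rump2012, Thm 4.3 eq. (4.2)] -/
theorem theorem43_lt (hp : 1 ≤ p) (hfl : IsRoundNearest p emin fl) (hsym : ∀ t, fl (-t) = -fl t)
    (qs : List ℚ) (hn : ((qs.length : ℚ) - 1) * unitRoundoff p ≤ 1)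
    (hS0 : flSumAbs fl (qs.map fl) ≠ 0) :
    |flSum fl (qs.map fl) - qs.sum| <
      ((qs.length : ℚ) + 2) * unitRoundoff p * ufp (flSumAbs fl (qs.map fl)) +
        (qs.length : ℚ) * ((2 : ℚ) ^ emin / 2) := by
  have hu := u_pos (p := p)
  have hptF : ∀ x ∈ qs.map fl, IsFloat p emin x := by
    intro x hx; obtain ⟨q, -, rfl⟩ := List.mem_map.mp hx; exact (hfl q).1
  have h35 := theorem35 hp hfl hsym hptF
  have hsa := sum_abs_le_flSumAbs_add hp hfl hsym hptF
  have hrd := abs_sum_map_fl_sub_sum_le hp hfl qs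
  rw [List.length_map] at h35 hsa
  set S := flSumAbs fl (qs.map fl) with hSdef
  set r := ufp S with hrdef
  have hr0 : 0 ≤ r := ufp_nonneg _
  have hS2r : S < 2 * r := (le_abs_self S).trans_lt (abs_lt_two_mul_ufp hS0)
  have h1 : unitRoundoff p * ((qs.map fl).map abs).sum ≤
      unitRoundoff p * (S + ((qs.length : ℚ) - 1) * unitRoundoff p * r) :=
    mul_le_mul_of_nonneg_left hsa hu.le
  have h2 : ((qs.length : ℚ) - 1) * unitRoundoff p * (unitRoundoff p * r) ≤ 1 * (unitRoundoff p * r) :=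
    mul_le_mul_of_nonneg_right hn (by positivity)
  calc |flSum fl (qs.map fl) - qs.sum|
      = |(flSum fl (qs.map fl) - (qs.map fl).sum) + ((qs.map fl).sum - qs.sum)| := by ring_nf
    _ ≤ |flSum fl (qs.map fl) - (qs.map fl).sum| + |(qs.map fl).sum - qs.sum| := abs_add_le _ _
    _ ≤ ((qs.length : ℚ) - 1) * unitRoundoff p * r +
          (unitRoundoff p * ((qs.map fl).map abs).sum + (qs.length : ℚ) * ((2 : ℚ) ^ emin / 2)) :=
        add_le_add h35 hrd
    _ < _ := by nlinarith [mul_lt_mul_of_pos_left hS2r hu]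

/-- **Theorem 4.3** (second inequality of (4.2)): `(n+2)u ≤ 1` ⟹
`|s̃ₙ − Σpᵢ| < (n+2)u·ufp(S̃ₙ) + realmin` (`n·eta/2 < realmin = ½u⁻¹eta` since `n < u⁻¹`). For ANY
rationals `pᵢ` with `p̃ᵢ = fl(pᵢ)`; sign-symmetric tie rule. [cite: Rump2012, Thm 4.3 eq. (4.2)] -/
theorem theorem43 (hfl : IsRoundNearest p emin fl) (hsym : ∀ t, fl (-t) = -fl t) (qs : List ℚ)
    (hn : ((qs.length : ℚ) + 2) * unitRoundoff p ≤ 1) :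
    |flSum fl (qs.map fl) - qs.sum| <
      ((qs.length : ℚ) + 2) * unitRoundoff p * ufp (flSumAbs fl (qs.map fl)) +
        (2 : ℚ) ^ (emin + p - 1) := by
  have hp : 1 ≤ p := one_le_prec_of_mul_u_le_one (by simp) hn
  have hu := u_pos (p := p)
  have h := theorem43_le hp hfl hsym qs (by nlinarith)
  have hnlt : (qs.length : ℚ) < 2 ^ p := by linarith [le_two_pow_of_mul_u_le_one hn]
  have hη : (qs.length : ℚ) * ((2 : ℚ) ^ emin / 2) < (2 : ℚ) ^ (emin + p - 1) := by
    rw [two_zpow_emin_add_p_sub_one]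
    have := two_zpow_pos emin
    nlinarith
  linarith

/-- **Theorem 4.3 for the dot product** `xᵀy` of two vectors of equal length `n` (Algorithm 4.2:
`p̃ᵢ = fl(xᵢyᵢ)`), `(n+2)u ≤ 1`: `|s̃ₙ − xᵀy| < (n+2)u·ufp(S̃ₙ) + realmin`. [cite: Rump2012, Thm 4.3 eq. (4.2)] -/
theorem theorem43_dot (hfl : IsRoundNearest p emin fl) (hsym : ∀ t, fl (-t) = -fl t) (xs ys : List ℚ)
    (hlen : ys.length = xs.length) (hn : ((xs.length : ℚ) + 2) * unitRoundoff p ≤ 1) :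
    |flDot fl xs ys - (List.zipWith (· * ·) xs ys).sum| <
      ((xs.length : ℚ) + 2) * unitRoundoff p * ufp (flDotAbs fl xs ys) + (2 : ℚ) ^ (emin + p - 1) := by
  have hl : (List.zipWith (· * ·) xs ys).length = xs.length := by simp [hlen]
  have h := theorem43 hfl hsym (List.zipWith (· * ·) xs ys) (by rw [hl]; exact hn)
  rw [hl] at h
  exact h

/-- Reading note (iii): the first `<` of (4.2) fails when `S̃ₙ = 0` — for `n = 1`, `p₁ = x₁y₁ = eta/2`
(`x₁ = eta`, `y₁ = 1/2`) and a rounding with `fl(eta/2) = 0` (the midpoint of `0` and `eta`; ties-to-even),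
`s̃₁ = S̃₁ = 0` and the error EQUALS `n·eta/2 = (n+2)u·ufp(S̃ₙ) + n·eta/2`.
[cite: Rump2012, Thm 4.3 eq. (4.2)] -/
theorem theorem43_first_lt_fails_at_zero (htie : fl ((2 : ℚ) ^ emin / 2) = 0) :
    flSumAbs fl ([(2 : ℚ) ^ emin / 2].map fl) = 0 ∧
    |flSum fl ([(2 : ℚ) ^ emin / 2].map fl) - [(2 : ℚ) ^ emin / 2].sum| =
      (([(2 : ℚ) ^ emin / 2].length : ℚ) + 2) * unitRoundoff p *
          ufp (flSumAbs fl ([(2 : ℚ) ^ emin / 2].map fl)) +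
        ([(2 : ℚ) ^ emin / 2].length : ℚ) * ((2 : ℚ) ^ emin / 2) := by
  have h1 : flSumAbs fl ([(2 : ℚ) ^ emin / 2].map fl) = 0 := by
    simp [flSumAbs, flSum, htie]
  have h2 : flSum fl ([(2 : ℚ) ^ emin / 2].map fl) = 0 := by simp [flSum, htie]
  have hpos : (0 : ℚ) < 2 ^ emin / 2 := by positivity
  refine ⟨h1, ?_⟩
  rw [h1, h2, ufp_zero, List.sum_cons, List.sum_nil, List.length_singleton, add_zero, zero_sub, abs_neg,
    abs_of_pos hpos]
  push_cast
  ring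

/-! ### §4: Corollary 4.4 — the dot-product bound computable in rounding to nearest -/

/-- The bound `R̃ = float((n+2)·(u·r) + ϱ) = fl(fl((n+2)·fl(u·r)) + ϱ)` of (4.6) (`r = ufp(S̃ₙ)`,
`ϱ = realmin` or `3/2·realmin`). [cite: Rump2012, Cor 4.4 eq. (4.6)] -/
def dotErrBound₁ (fl : ℚ → ℚ) (p n : ℕ) (ϱ r : ℚ) : ℚ :=
  fl (fl (((n : ℚ) + 2) * fl (unitRoundoff p * r)) + ϱ)

/-- The bound `R̂ = float(((n+2)·u)·r + ϱ) = fl(fl(fl((n+2)·u)·r) + ϱ)` of (4.6).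
[cite: Rump2012, Cor 4.4 eq. (4.6)] -/
def dotErrBound₂ (fl : ℚ → ℚ) (p n : ℕ) (ϱ r : ℚ) : ℚ :=
  fl (fl (fl (((n : ℚ) + 2) * unitRoundoff p) * r) + ϱ)

/-- `flSum` of a list of floats is `flAcc` started at `0` (`fl(0 + p₁) = p₁`).
[cite: Rump2012, Algorithm 3.1] -/
theorem flSum_eq_flAcc_zero (hfl : IsRoundNearest p emin fl) {l : List ℚ}
    (hl : ∀ x ∈ l, IsFloat p emin x) : flSum fl l = flAcc fl 0 l := by
  cases l with
  | nil => simp [flSum]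
  | cons x xs => rw [flSum_cons, flAcc_cons, zero_add, fl_eq_self hfl (hl x (by simp))]

/-- "Recursively applying (3.9)": summing a SUB-vector of nonnegative terms in the same order gives at most
the full sum — `l₁` a sublist of `l₂`, `0 ≤ a ≤ b` floats ⟹ `flAcc a l₁ ≤ flAcc b l₂`.
[cite: Rump2012, proof of Cor 4.4 ("0 ≤ S̃*ₙ ≤ S̃ₙ because the order of summation is not changed")] -/
theorem flAcc_le_flAcc_of_sublist (hfl : IsRoundNearest p emin fl) {l₁ l₂ : List ℚ}
    (h : l₁.Sublist l₂) :
    ∀ {a b : ℚ}, IsFloat p emin a → IsFloat p emin b → a ≤ b → (∀ y ∈ l₂, 0 ≤ y) →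
      flAcc fl a l₁ ≤ flAcc fl b l₂ := by
  induction h with
  | slnil => intro a b _ _ hab _; simpa using hab
  | cons y _ ih =>
      intro a b ha hb hab hl₂
      rw [flAcc_cons]
      have hy : 0 ≤ y := hl₂ y (by simp)
      exact ih ha (hfl _).1 (hab.trans (le_fl_of_le hfl hb (by linarith)))
        (fun z hz => hl₂ z (by simp [hz]))
  | cons_cons y _ ih =>
      intro a b ha hb hab hl₂
      rw [flAcc_cons, flAcc_cons]
      exact ih (hfl _).1 (hfl _).1 (fl_mono hfl (by linarith)) (fun z hz => hl₂ z (by simp [hz]))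

/-- Sub-vector monotonicity for `flSum` of nonnegative floats: `l₁ <+ l₂ ⟹ flSum l₁ ≤ flSum l₂`; with
`l₁ = []`, `0 ≤ flSum l₂`. [cite: Rump2012, proof of Cor 4.4 ("0 ≤ S̃*ₙ ≤ S̃ₙ")] -/
theorem flSum_le_flSum_of_sublist (hfl : IsRoundNearest p emin fl) {l₁ l₂ : List ℚ}
    (h : l₁.Sublist l₂) (hl₂ : ∀ y ∈ l₂, IsFloat p emin y ∧ 0 ≤ y) : flSum fl l₁ ≤ flSum fl l₂ := by
  rw [flSum_eq_flAcc_zero hfl (fun x hx => (hl₂ x (h.subset hx)).1),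
    flSum_eq_flAcc_zero hfl (fun x hx => (hl₂ x hx).1)]
  exact flAcc_le_flAcc_of_sublist hfl h (isFloat_zero p emin) (isFloat_zero p emin) le_rfl
    (fun y hy => (hl₂ y hy).2)

/-- (4.9): splitting the rounding errors of the products at `realmin` — with `I = {i : |p̃ᵢ| < realmin}`,
`|Σ(p̃ᵢ − pᵢ)| ≤ u·Σ_{i∉I}|p̃ᵢ| + |I|·eta/2`; here `Σ_{i∉I}|p̃ᵢ|` is the sum of the sub-vector
`(|p̃ᵢ|).filter (realmin ≤ ·)` and `|I| = n − its length`. [cite: Rump2012, proof of Cor 4.4 eq. (4.9)] -/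
theorem abs_sum_sub_le_split (hp : 1 ≤ p) (hfl : IsRoundNearest p emin fl) :
    ∀ qs : List ℚ,
      |(qs.map fl).sum - qs.sum| ≤
        unitRoundoff p *
            (((qs.map fl).map abs).filter (fun a => decide ((2 : ℚ) ^ (emin + p - 1) ≤ a))).sum +
          ((qs.length : ℚ) -
              ((((qs.map fl).map abs).filter (fun a => decide ((2 : ℚ) ^ (emin + p - 1) ≤ a))).length : ℚ)) *
            ((2 : ℚ) ^ emin / 2)
  | [] => by simp
  | q :: qs => by
      have ih := abs_sum_sub_le_split hp hfl qs
      have hsplit : |fl q + (qs.map fl).sum - (q + qs.sum)| ≤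
          |fl q - q| + |(qs.map fl).sum - qs.sum| := by
        calc |fl q + (qs.map fl).sum - (q + qs.sum)| = |(fl q - q) + ((qs.map fl).sum - qs.sum)| := by
              ring_nf
          _ ≤ _ := abs_add_le _ _
      have hu := u_pos (p := p)
      by_cases hq : (2 : ℚ) ^ (emin + p - 1) ≤ |fl q|
      · have h1 := abs_fl_sub_le_u_abs_fl_of_le hp hfl hq
        simp only [List.map_cons, List.filter_cons, hq, decide_true, ↓reduceIte, List.sum_cons,
          List.length_cons, Nat.cast_succ] at ih ⊢
        linarith
      · have h1 := abs_fl_sub_le_half_eta_of_abs_fl_lt hp hfl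
          ((not_le.mp hq).trans (zpow_lt_zpow_right₀ (by norm_num) (by omega)))
        simp only [List.map_cons, List.filter_cons, hq, decide_false, Bool.false_eq_true, ↓reduceIte,
          List.sum_cons, List.length_cons, Nat.cast_succ] at ih ⊢
        linarith

/-- **(4.8), the first case of Corollary 4.4**: if `ufp(S̃ₙ) ≥ u⁻¹realmin` (indeed `S̃ₙ ≥ 2^(emin+2p-1)`)
and `(n−1)u ≤ 1`, then `|Σ(p̃ᵢ − pᵢ)| ≤ 3u·ufp(S̃ₙ)` and hence `|s̃ₙ − Σpᵢ| ≤ (n+2)u·ufp(S̃ₙ) =: Φ`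
(no underflow term). [cite: Rump2012, proof of Cor 4.4 eq. (4.8)–(4.9)] -/
theorem err_le_phi_of_large (hp : 1 ≤ p) (hfl : IsRoundNearest p emin fl) (hsym : ∀ t, fl (-t) = -fl t)
    (qs : List ℚ) (hn : ((qs.length : ℚ) - 1) * unitRoundoff p ≤ 1)
    (hbig : (2 : ℚ) ^ (emin + 2 * p - 1) ≤ flSumAbs fl (qs.map fl)) :
    |flSum fl (qs.map fl) - qs.sum| ≤
      ((qs.length : ℚ) + 2) * unitRoundoff p * ufp (flSumAbs fl (qs.map fl)) := by
  have hu := u_pos (p := p)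
  set pt := qs.map fl with hpt
  have hptF : ∀ x ∈ pt, IsFloat p emin x := by
    intro x hx; obtain ⟨q, -, rfl⟩ := List.mem_map.mp hx; exact (hfl q).1
  have hlen : pt.length = qs.length := List.length_map _
  set S := flSumAbs fl pt with hSdef
  set r := ufp S with hrdef
  have hS0 : 0 ≤ S := flSumAbs_nonneg hfl hptF
  have hr : (2 : ℚ) ^ (emin + 2 * p - 1) ≤ r := two_zpow_le_ufp (by rwa [abs_of_nonneg hS0])
  have hr0 : 0 ≤ r := ufp_nonneg _
  -- the sub-vector of the normal |p̃ᵢ|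
  set L := pt.map abs with hLdef
  set Lbig := L.filter (fun a => decide ((2 : ℚ) ^ (emin + p - 1) ≤ a)) with hLbigdef
  have hL : ∀ y ∈ L, IsFloat p emin y ∧ 0 ≤ y := by
    intro y hy; obtain ⟨z, hz, rfl⟩ := List.mem_map.mp hy; exact ⟨isFloat_abs (hptF z hz), abs_nonneg z⟩
  have hsub : Lbig.Sublist L := List.filter_sublist
  have hLbig : ∀ y ∈ Lbig, IsFloat p emin y ∧ 0 ≤ y := fun y hy => hL y (hsub.subset hy)
  have hmlen : Lbig.length ≤ qs.length := by
    have := List.length_filter_le (fun a => decide ((2 : ℚ) ^ (emin + p - 1) ≤ a)) L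
    rw [hLdef, List.length_map, hlen] at this; exact this
  -- S* := flSum Lbig, 0 ≤ S* ≤ S
  have hSstar_le : flSum fl Lbig ≤ S := by
    have := flSum_le_flSum_of_sublist hfl hsub hL
    exact this
  have hSstar0 : 0 ≤ flSum fl Lbig := by
    have := flSum_le_flSum_of_sublist hfl (List.nil_sublist Lbig) hLbig
    simpa [flSum] using this
  have hufp_star : ufp (flSum fl Lbig) ≤ r :=
    ufp_mono (by rw [abs_of_nonneg hSstar0, abs_of_nonneg hS0]; exact hSstar_le)
  -- Theorem 3.5 on the sub-vector: Lbig.sum ≤ S* + (m−1)u·ufp(S*)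
  have h35 := theorem35 hp hfl hsym (ps := Lbig) (fun y hy => (hLbig y hy).1)
  have hmapabs : Lbig.map abs = Lbig := by
    conv_rhs => rw [← List.map_id' Lbig]
    exact List.map_congr_left (fun a ha => abs_of_nonneg (hLbig a ha).2)
  have hSA : flSumAbs fl Lbig = flSum fl Lbig := by rw [flSumAbs, hmapabs]
  rw [hSA] at h35
  have hsum1 : Lbig.sum ≤ flSum fl Lbig + ((Lbig.length : ℚ) - 1) * unitRoundoff p * ufp (flSum fl Lbig) := by
    linarith [(abs_le.mp h35).1]
  -- u·Lbig.sum ≤ 2ur + (m−1)u²r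
  have hstar2 : flSum fl Lbig ≤ 2 * ufp (flSum fl Lbig) :=
    (le_abs_self _).trans (abs_le_two_mul_ufp _)
  have hsum2 : Lbig.sum ≤ 2 * r + ((Lbig.length : ℚ) - 1) * unitRoundoff p * r := by
    rcases Nat.eq_zero_or_pos Lbig.length with hm0 | hm0
    · have : Lbig = [] := List.length_eq_zero_iff.mp hm0
      rw [this]
      have hu1 : unitRoundoff p ≤ 1 := by
        rw [unitRoundoff, div_le_one (by positivity)]; exact one_le_pow₀ (by norm_num)
      have := mul_le_mul_of_nonneg_right hu1 hr0
      simp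
      linarith
    · have hm1 : (0 : ℚ) ≤ (Lbig.length : ℚ) - 1 := by
        have : (1 : ℚ) ≤ Lbig.length := by exact_mod_cast hm0
        linarith
      have h3 : ((Lbig.length : ℚ) - 1) * unitRoundoff p * ufp (flSum fl Lbig) ≤
          ((Lbig.length : ℚ) - 1) * unitRoundoff p * r :=
        mul_le_mul_of_nonneg_left hufp_star (mul_nonneg hm1 hu.le)
      linarith
  -- eta/2 ≤ u²·r from r ≥ u⁻¹realmin
  have hη : (2 : ℚ) ^ emin / 2 ≤ unitRoundoff p * unitRoundoff p * r := by
    have e : unitRoundoff p * unitRoundoff p * (2 : ℚ) ^ (emin + 2 * p - 1) = (2 : ℚ) ^ emin / 2 := by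
      rw [two_zpow_emin_add_two_p_sub_one, unitRoundoff]; field_simp
    rw [← e]
    exact mul_le_mul_of_nonneg_left hr (by positivity)
  have hsplit := abs_sum_sub_le_split hp hfl qs
  rw [← hpt, ← hLdef, ← hLbigdef] at hsplit
  have hk0 : (0 : ℚ) ≤ (qs.length : ℚ) - (Lbig.length : ℚ) := by
    have : (Lbig.length : ℚ) ≤ qs.length := by exact_mod_cast hmlen
    linarith
  have hprod : |pt.sum - qs.sum| ≤ 3 * unitRoundoff p * r := by
    have h1 : unitRoundoff p * Lbig.sum ≤
        unitRoundoff p * (2 * r + ((Lbig.length : ℚ) - 1) * unitRoundoff p * r) :=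
      mul_le_mul_of_nonneg_left hsum2 hu.le
    have h2 : ((qs.length : ℚ) - (Lbig.length : ℚ)) * ((2 : ℚ) ^ emin / 2) ≤
        ((qs.length : ℚ) - (Lbig.length : ℚ)) * (unitRoundoff p * unitRoundoff p * r) :=
      mul_le_mul_of_nonneg_left hη hk0
    have h3 : ((qs.length : ℚ) - 1) * unitRoundoff p * (unitRoundoff p * r) ≤ 1 * (unitRoundoff p * r) :=
      mul_le_mul_of_nonneg_right hn (by positivity)
    nlinarith
  have h35pt := theorem35 hp hfl hsym hptF
  rw [hlen] at h35pt
  calc |flSum fl pt - qs.sum| = |(flSum fl pt - pt.sum) + (pt.sum - qs.sum)| := by ring_nf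
    _ ≤ |flSum fl pt - pt.sum| + |pt.sum - qs.sum| := abs_add_le _ _
    _ ≤ ((qs.length : ℚ) - 1) * unitRoundoff p * r + 3 * unitRoundoff p * r := add_le_add h35pt hprod
    _ = ((qs.length : ℚ) + 2) * unitRoundoff p * r := by ring

/-- The second case of Corollary 4.4: `S̃ₙ < u⁻¹eta` ⟹ no rounding error in the sums and every
`|p̃ᵢ − pᵢ| ≤ eta/2`, so `|s̃ₙ − Σpᵢ| ≤ n·eta/2`. [cite: Rump2012, proof of Cor 4.4 (second case)] -/
theorem err_le_of_small (hp : 1 ≤ p) (hfl : IsRoundNearest p emin fl) (hsym : ∀ t, fl (-t) = -fl t)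
    (qs : List ℚ) (hsmall : flSumAbs fl (qs.map fl) < (2 : ℚ) ^ (emin + p)) :
    |flSum fl (qs.map fl) - qs.sum| ≤ (qs.length : ℚ) * ((2 : ℚ) ^ emin / 2) := by
  have hptF : ∀ x ∈ qs.map fl, IsFloat p emin x := by
    intro x hx; obtain ⟨q, -, rfl⟩ := List.mem_map.mp hx; exact (hfl q).1
  obtain ⟨h1, -⟩ := flSum_exact_of_flSumAbs_lt hp hfl hsym hptF hsmall
  rw [h1]
  have hle := abs_le_flSumAbs hfl hptF
  have key : ∀ l : List ℚ, (∀ q ∈ l, |fl q| < (2 : ℚ) ^ (emin + p)) →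
      |(l.map fl).sum - l.sum| ≤ (l.length : ℚ) * ((2 : ℚ) ^ emin / 2) := by
    intro l
    induction l with
    | nil => intro _; simp
    | cons q l ih =>
        intro hl
        have hq := abs_fl_sub_le_half_eta_of_abs_fl_lt hp hfl (hl q (by simp))
        have ih' := ih (fun w hw => hl w (by simp [hw]))
        simp only [List.map_cons, List.sum_cons, List.length_cons, Nat.cast_succ]
        calc |fl q + (l.map fl).sum - (q + l.sum)| = |(fl q - q) + ((l.map fl).sum - l.sum)| := by ring_nf
          _ ≤ |fl q - q| + |(l.map fl).sum - l.sum| := abs_add_le _ _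
          _ ≤ _ := by linarith
  exact key qs (fun q hq => (hle (fl q) (List.mem_map.mpr ⟨q, hq, rfl⟩)).trans_lt hsmall)

/-- `(2.10)` lower estimate in the normal range: `realmin ≤ t`, `|t| < 2^(k+1)` ⟹ `fl(t) ≥ t − u·2^k`
(`fl(t) ≥ t − u·ufp(t)` and `ufp(t) ≤ 2^k`). [cite: Rump2012, §2 eq. (2.10) and proof of Cor 4.4] -/
theorem sub_le_fl_of_abs_lt (hp : 1 ≤ p) (hfl : IsRoundNearest p emin fl) {t : ℚ} {k : ℤ}
    (ht : (2 : ℚ) ^ (emin + p - 1) ≤ t) (hk : |t| < (2 : ℚ) ^ (k + 1)) :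
    t - unitRoundoff p * (2 : ℚ) ^ k ≤ fl t := by
  have h1 := abs_fl_sub_le_u_ufp hp hfl (r := t) (by rwa [abs_of_nonneg ((two_zpow_pos _).le.trans ht)])
  have h2 : ufp t ≤ (2 : ℚ) ^ k := ufp_le_two_zpow_of_abs_lt hk
  have h3 := mul_le_mul_of_nonneg_left h2 (u_pos (p := p)).le
  linarith [(abs_le.mp h1).1]

/-- The bound `fl((n+2)·fl(u·r))` inside `R̃`: a nonnegative float, and EQUAL to `Φ = (n+2)u·ufp(S̃ₙ)` as
soon as `S̃ₙ ≥ u⁻¹eta` (then `u·r = 2^(K−p) ∈ F` and `(n+2)·2^(K−p) ∈ F`, `(n+2)u ≤ 1`).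
[cite: Rump2012, proof of Cor 4.4 ("both products do not cause a rounding error")] -/
theorem boundA₁_facts (hp : 1 ≤ p) (hfl : IsRoundNearest p emin fl) (n : ℕ)
    (hn : ((n : ℚ) + 2) * unitRoundoff p ≤ 1) {S : ℚ} (hS0 : 0 ≤ S) :
    IsFloat p emin (fl (((n : ℚ) + 2) * fl (unitRoundoff p * ufp S))) ∧
    0 ≤ fl (((n : ℚ) + 2) * fl (unitRoundoff p * ufp S)) ∧
    ((2 : ℚ) ^ (emin + p) ≤ S →
      fl (((n : ℚ) + 2) * fl (unitRoundoff p * ufp S)) = ((n : ℚ) + 2) * unitRoundoff p * ufp S) := by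
  have hu := u_pos (p := p)
  refine ⟨(hfl _).1, fl_nonneg hfl (mul_nonneg (by positivity) (fl_nonneg hfl
    (mul_nonneg hu.le (ufp_nonneg _)))), fun hge => ?_⟩
  have hSne : S ≠ 0 := by intro h0; rw [h0] at hge; exact absurd hge (not_le.mpr (two_zpow_pos _))
  obtain ⟨K, hK⟩ := exists_ufp_eq_two_zpow hSne
  have hKge : emin + p ≤ K := by
    have h1 : (2 : ℚ) ^ (emin + p) ≤ ufp S := two_zpow_le_ufp (by rwa [abs_of_nonneg hS0])
    rw [hK] at h1
    exact (zpow_le_zpow_iff_right₀ (by norm_num : (1 : ℚ) < 2)).mp h1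
  have e1 : fl (unitRoundoff p * ufp S) = (2 : ℚ) ^ (K - p) := by
    rw [hK, u_mul_two_zpow]; exact fl_eq_self hfl (isFloat_two_zpow hp (by omega))
  have hNF : IsFloat p emin (((n : ℚ) + 2) * (2 : ℚ) ^ (K - p)) := by
    have := isFloat_natCast_mul_two_zpow (emin := emin) hp (N := n + 2)
      (by push_cast; exact le_two_pow_of_mul_u_le_one hn) (e := K - p) (by omega)
    push_cast at this; exact this
  rw [e1, fl_eq_self hfl hNF, hK, mul_assoc, u_mul_two_zpow]

/-- The bound `fl(fl((n+2)·u)·r)` inside `R̂`: a nonnegative float, and EQUAL to `Φ = (n+2)u·ufp(S̃ₙ)` as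
soon as `S̃ₙ ≥ u⁻¹eta`, PROVIDED `(n+2)·u = (n+2)·2^-p ∈ F`, i.e. under the format side condition
`emin + p ≤ 0` (reading note (iv)). [cite: Rump2012, proof of Cor 4.4 and Remark 9] -/
theorem boundA₂_facts (hp : 1 ≤ p) (he : emin + p ≤ 0) (hfl : IsRoundNearest p emin fl) (n : ℕ)
    (hn : ((n : ℚ) + 2) * unitRoundoff p ≤ 1) {S : ℚ} (hS0 : 0 ≤ S) :
    IsFloat p emin (fl (fl (((n : ℚ) + 2) * unitRoundoff p) * ufp S)) ∧
    0 ≤ fl (fl (((n : ℚ) + 2) * unitRoundoff p) * ufp S) ∧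
    ((2 : ℚ) ^ (emin + p) ≤ S →
      fl (fl (((n : ℚ) + 2) * unitRoundoff p) * ufp S) = ((n : ℚ) + 2) * unitRoundoff p * ufp S) := by
  have hu := u_pos (p := p)
  have hcu : IsFloat p emin (((n : ℚ) + 2) * unitRoundoff p) := by
    have := isFloat_natCast_mul_two_zpow (emin := emin) hp (N := n + 2)
      (by push_cast; exact le_two_pow_of_mul_u_le_one hn) (e := -(p : ℤ)) (by omega)
    push_cast at this
    rw [unitRoundoff, one_div, ← zpow_natCast, ← zpow_neg]; exact this
  have e0 : fl (((n : ℚ) + 2) * unitRoundoff p) = ((n : ℚ) + 2) * unitRoundoff p := fl_eq_self hfl hcu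
  rw [e0]
  refine ⟨(hfl _).1, fl_nonneg hfl (mul_nonneg (by positivity) (ufp_nonneg _)), fun hge => ?_⟩
  have hSne : S ≠ 0 := by intro h0; rw [h0] at hge; exact absurd hge (not_le.mpr (two_zpow_pos _))
  obtain ⟨K, hK⟩ := exists_ufp_eq_two_zpow hSne
  have hKge : emin + p ≤ K := by
    have h1 : (2 : ℚ) ^ (emin + p) ≤ ufp S := two_zpow_le_ufp (by rwa [abs_of_nonneg hS0])
    rw [hK] at h1
    exact (zpow_le_zpow_iff_right₀ (by norm_num : (1 : ℚ) < 2)).mp h1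
  have hNF : IsFloat p emin (((n : ℚ) + 2) * (2 : ℚ) ^ (K - p)) := by
    have := isFloat_natCast_mul_two_zpow (emin := emin) hp (N := n + 2)
      (by push_cast; exact le_two_pow_of_mul_u_le_one hn) (e := K - p) (by omega)
    push_cast at this; exact this
  have e2 : ((n : ℚ) + 2) * unitRoundoff p * (2 : ℚ) ^ K = ((n : ℚ) + 2) * (2 : ℚ) ^ (K - p) := by
    rw [mul_assoc, u_mul_two_zpow]
  rw [hK, e2, fl_eq_self hfl hNF]

/-- Remark 8: `ϱ = 3/2·realmin = 3·2^(emin+p-2) ∈ F` (`p ≥ 2`), so `fl(3/2·realmin) = ϱ`.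
[cite: Rump2012, Remark 8] -/
theorem isFloat_rho (hp : 2 ≤ p) : IsFloat p emin (3 / 2 * (2 : ℚ) ^ (emin + p - 1)) := by
  have h3 : |(3 : ℤ)| < 2 ^ p := by
    rw [abs_of_nonneg (by norm_num)]
    calc (3 : ℤ) < 2 ^ 2 := by norm_num
      _ ≤ 2 ^ p := pow_le_pow_right₀ (by norm_num) hp
  have h := isFloat_of_int_mul (p := p) (emin := emin) 3 (emin + p - 2) h3 (by omega)
  have e : (3 : ℚ) / 2 * (2 : ℚ) ^ (emin + p - 1) = ((3 : ℤ) : ℚ) * (2 : ℚ) ^ (emin + p - 2) := by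
    rw [show emin + (p : ℤ) - 1 = (emin + p - 2) + 1 by ring, zpow_add_one₀ (by norm_num : (2 : ℚ) ≠ 0)]
    push_cast; ring
  rw [e]; exact h

/-- The case analysis of **Corollary 4.4** for a generic inner bound `A` and additive term `ϱ`: if `A` is a
nonnegative float equal to `Φ = (n+2)u·ufp(S̃ₙ)` whenever `S̃ₙ ≥ u⁻¹eta`, `ϱ ≥ realmin` is a float, and in
the middle range `u⁻¹eta ≤ S̃ₙ < u⁻¹realmin` one has `fl(Φ + ϱ) > Φ + n·eta/2`, then
`|s̃ₙ − Σpᵢ| ≤ fl(A + ϱ)` (`(n+2)u ≤ 1`). [cite: Rump2012, proof of Cor 4.4 (three cases)] -/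
theorem corollary44_of_cases (hp : 1 ≤ p) (hfl : IsRoundNearest p emin fl) (hsym : ∀ t, fl (-t) = -fl t)
    (qs : List ℚ) (hn : ((qs.length : ℚ) + 2) * unitRoundoff p ≤ 1) {ϱ A : ℚ}
    (hϱF : IsFloat p emin ϱ) (hϱ : (2 : ℚ) ^ (emin + p - 1) ≤ ϱ) (hAF : IsFloat p emin A) (hA0 : 0 ≤ A)
    (hAΦ : (2 : ℚ) ^ (emin + p) ≤ flSumAbs fl (qs.map fl) →
      A = ((qs.length : ℚ) + 2) * unitRoundoff p * ufp (flSumAbs fl (qs.map fl)))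
    (hmid : (2 : ℚ) ^ (emin + p) ≤ flSumAbs fl (qs.map fl) →
      flSumAbs fl (qs.map fl) < (2 : ℚ) ^ (emin + 2 * p - 1) →
      ((qs.length : ℚ) + 2) * unitRoundoff p * ufp (flSumAbs fl (qs.map fl)) +
          (qs.length : ℚ) * ((2 : ℚ) ^ emin / 2) <
        fl (((qs.length : ℚ) + 2) * unitRoundoff p * ufp (flSumAbs fl (qs.map fl)) + ϱ)) :
    |flSum fl (qs.map fl) - qs.sum| ≤ fl (A + ϱ) := by
  have hu := u_pos (p := p)
  have hn' : ((qs.length : ℚ) - 1) * unitRoundoff p ≤ 1 := by nlinarith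
  have hnlt : (qs.length : ℚ) < 2 ^ p := by linarith [le_two_pow_of_mul_u_le_one hn]
  rcases lt_or_ge (flSumAbs fl (qs.map fl)) ((2 : ℚ) ^ (emin + p)) with hsmall | hge
  · -- second case: total error ≤ n·eta/2 < realmin ≤ ϱ ≤ fl(A + ϱ)
    have h1 := err_le_of_small hp hfl hsym qs hsmall
    have h2 : (qs.length : ℚ) * ((2 : ℚ) ^ emin / 2) < (2 : ℚ) ^ (emin + p - 1) := by
      rw [two_zpow_emin_add_p_sub_one]; have := two_zpow_pos emin; nlinarith
    have h3 : ϱ ≤ fl (A + ϱ) := le_fl_of_le hfl hϱF (by linarith)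
    linarith
  rcases le_or_gt ((2 : ℚ) ^ (emin + 2 * p - 1)) (flSumAbs fl (qs.map fl)) with hbig | hmidr
  · -- first case: error ≤ Φ = A ≤ fl(A + ϱ)
    have h1 := err_le_phi_of_large hp hfl hsym qs hn' hbig
    rw [← hAΦ hge] at h1
    have h3 : A ≤ fl (A + ϱ) := le_fl_of_le hfl hAF (by linarith [(two_zpow_pos (emin + p - 1)).trans_le hϱ])
    linarith
  · -- third case
    have h1 := theorem43_le hp hfl hsym qs hn'
    have h2 := hmid hge hmidr
    rw [hAΦ hge]
    linarith

/-- The middle-range estimate for `ϱ = realmin` under `2(n+2)u ≤ 1`: `u⁻¹eta ≤ S̃ₙ < u⁻¹realmin` ⟹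
`Φ ≤ ¼u⁻¹realmin`, `ufp(Φ + ϱ) ≤ ½u⁻¹realmin`, `fl(Φ + ϱ) ≥ Φ + realmin/2 > Φ + n·eta/2` (the source has
`¾realmin` via `ufp ≤ ¼u⁻¹realmin` for `p ≥ 3`; the weaker chain suffices and covers `p = 2`).
[cite: Rump2012, proof of Cor 4.4 (third case, second subcase)] -/
theorem hmid_realmin (hp : 2 ≤ p) (hfl : IsRoundNearest p emin fl) (n : ℕ)
    (hn : 2 * (((n : ℚ) + 2) * unitRoundoff p) ≤ 1) {S : ℚ} (hS0 : 0 ≤ S)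
    (hlt : S < (2 : ℚ) ^ (emin + 2 * p - 1)) :
    ((n : ℚ) + 2) * unitRoundoff p * ufp S + (n : ℚ) * ((2 : ℚ) ^ emin / 2) <
      fl (((n : ℚ) + 2) * unitRoundoff p * ufp S + (2 : ℚ) ^ (emin + p - 1)) := by
  have hu := u_pos (p := p)
  have hp1 : 1 ≤ p := by omega
  set r := ufp S with hr
  set Φ := ((n : ℚ) + 2) * unitRoundoff p * r with hΦ
  have hr0 : 0 ≤ r := ufp_nonneg _
  have hrle : r ≤ (2 : ℚ) ^ (emin + 2 * p - 2) :=
    ufp_le_two_zpow_of_abs_lt (by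
      rw [abs_of_nonneg hS0, show emin + 2 * (p : ℤ) - 2 + 1 = emin + 2 * p - 1 by ring]; exact hlt)
  have hΦ0 : 0 ≤ Φ := by positivity
  have hΦle : Φ ≤ r / 2 := by
    have h1 : ((n : ℚ) + 2) * unitRoundoff p ≤ 1 / 2 := by linarith
    have h2 := mul_le_mul_of_nonneg_right h1 hr0
    linarith
  -- numeric forms: X := eta·2^p, realmin = X/2, 2^(emin+2p-2) = X·2^p/4, 2^(emin+2p-1) = X·2^p/2
  have eRM := two_zpow_emin_add_p_sub_one (p := p) (emin := emin)
  have e22 := two_zpow_emin_add_two_p_sub_two (p := p) (emin := emin)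
  have e21 := two_zpow_emin_add_two_p_sub_one (p := p) (emin := emin)
  have hη := two_zpow_pos emin
  have hP : (4 : ℚ) ≤ 2 ^ p := by
    calc (4 : ℚ) = 2 ^ 2 := by norm_num
      _ ≤ 2 ^ p := pow_le_pow_right₀ (by norm_num) hp
  have hX : (0 : ℚ) < 2 ^ emin * 2 ^ p := by positivity
  have hX4 : (2 : ℚ) ^ emin * 2 ^ p * 4 ≤ (2 : ℚ) ^ emin * 2 ^ p * 2 ^ p :=
    mul_le_mul_of_nonneg_left hP hX.le
  have hnP : 2 * ((n : ℚ) + 2) ≤ 2 ^ p := by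
    have := le_two_pow_of_mul_u_le_one (p := p) (c := 2 * ((n : ℚ) + 2)) (by linarith)
    linarith
  rw [e22] at hrle
  -- |Φ + ϱ| < 2^(emin+2p-1), so ufp(Φ + ϱ) ≤ 2^(emin+2p-2) and fl(Φ + ϱ) ≥ Φ + ϱ − u·2^(emin+2p-2)
  have habs : |Φ + (2 : ℚ) ^ (emin + p - 1)| < (2 : ℚ) ^ (emin + 2 * p - 2 + 1) := by
    rw [show emin + 2 * (p : ℤ) - 2 + 1 = emin + 2 * p - 1 by ring, abs_of_nonneg (by positivity), e21,
      eRM]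
    linarith
  have hfl_ge := sub_le_fl_of_abs_lt hp1 hfl (t := Φ + (2 : ℚ) ^ (emin + p - 1)) (by linarith) habs
  have e3 : unitRoundoff p * (2 ^ emin * 2 ^ p * 2 ^ p / 4) = 2 ^ emin * 2 ^ p / 4 := by
    rw [unitRoundoff]; field_simp
  rw [e22, eRM, e3] at hfl_ge
  rw [eRM]
  have hn2 : 2 ^ emin * (2 * (n : ℚ)) < 2 ^ emin * 2 ^ p := mul_lt_mul_of_pos_left (by linarith) hη
  linarith

/-- The middle-range estimate for `ϱ = 3/2·realmin` under `(n+2)u ≤ 1` (`p ≥ 2`): `Φ ≤ ufp(S̃ₙ) ≤ ½u⁻¹realmin`,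
`ufp(Φ + ϱ) ≤ ½u⁻¹realmin`, `fl(Φ + ϱ) ≥ Φ + ϱ − ½realmin = Φ + realmin > Φ + n·eta/2`.
[cite: Rump2012, proof of Cor 4.4 (third case, first subcase)] -/
theorem hmid_rho (hp : 2 ≤ p) (hfl : IsRoundNearest p emin fl) (n : ℕ)
    (hn : ((n : ℚ) + 2) * unitRoundoff p ≤ 1) {S : ℚ} (hS0 : 0 ≤ S)
    (hlt : S < (2 : ℚ) ^ (emin + 2 * p - 1)) :
    ((n : ℚ) + 2) * unitRoundoff p * ufp S + (n : ℚ) * ((2 : ℚ) ^ emin / 2) <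
      fl (((n : ℚ) + 2) * unitRoundoff p * ufp S + 3 / 2 * (2 : ℚ) ^ (emin + p - 1)) := by
  have hu := u_pos (p := p)
  have hp1 : 1 ≤ p := by omega
  set r := ufp S with hr
  set Φ := ((n : ℚ) + 2) * unitRoundoff p * r with hΦ
  have hr0 : 0 ≤ r := ufp_nonneg _
  have hrle : r ≤ (2 : ℚ) ^ (emin + 2 * p - 2) :=
    ufp_le_two_zpow_of_abs_lt (by
      rw [abs_of_nonneg hS0, show emin + 2 * (p : ℤ) - 2 + 1 = emin + 2 * p - 1 by ring]; exact hlt)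
  have hΦ0 : 0 ≤ Φ := by positivity
  have hΦle : Φ ≤ r := by
    have h2 := mul_le_mul_of_nonneg_right hn hr0
    linarith
  have eRM := two_zpow_emin_add_p_sub_one (p := p) (emin := emin)
  have e22 := two_zpow_emin_add_two_p_sub_two (p := p) (emin := emin)
  have e21 := two_zpow_emin_add_two_p_sub_one (p := p) (emin := emin)
  have hη := two_zpow_pos emin
  have hP : (4 : ℚ) ≤ 2 ^ p := by
    calc (4 : ℚ) = 2 ^ 2 := by norm_num
      _ ≤ 2 ^ p := pow_le_pow_right₀ (by norm_num) hp
  have hX : (0 : ℚ) < 2 ^ emin * 2 ^ p := by positivity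
  have hX4 : (2 : ℚ) ^ emin * 2 ^ p * 4 ≤ (2 : ℚ) ^ emin * 2 ^ p * 2 ^ p :=
    mul_le_mul_of_nonneg_left hP hX.le
  have hnP : (n : ℚ) + 2 ≤ 2 ^ p := le_two_pow_of_mul_u_le_one hn
  rw [e22] at hrle
  have habs : |Φ + 3 / 2 * (2 : ℚ) ^ (emin + p - 1)| < (2 : ℚ) ^ (emin + 2 * p - 2 + 1) := by
    rw [show emin + 2 * (p : ℤ) - 2 + 1 = emin + 2 * p - 1 by ring, abs_of_nonneg (by positivity), e21,
      eRM]
    linarith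
  have hfl_ge := sub_le_fl_of_abs_lt hp1 hfl (t := Φ + 3 / 2 * (2 : ℚ) ^ (emin + p - 1))
    (by rw [eRM]; linarith) habs
  have e3 : unitRoundoff p * (2 ^ emin * 2 ^ p * 2 ^ p / 4) = 2 ^ emin * 2 ^ p / 4 := by
    rw [unitRoundoff]; field_simp
  rw [e22, eRM, e3] at hfl_ge
  rw [eRM]
  have hn2 : 2 ^ emin * (n : ℚ) < 2 ^ emin * 2 ^ p := mul_lt_mul_of_pos_left (by linarith) hη
  linarith

/-- **Corollary 4.4 with `R̃`**: `2(n+2)u ≤ 1`, `p̃ᵢ = fl(pᵢ)` (any rationals `pᵢ`, e.g. `xᵢyᵢ`), `s̃ₙ`, `S̃ₙ`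
by Algorithm 4.2, `r = ufp(S̃ₙ)` ⟹ `|s̃ₙ − Σpᵢ| ≤ R̃ = fl(fl((n+2)·fl(u·r)) + realmin)`. `p ≥ 2`
(automatic for `n ≥ 1`); sign-symmetric tie rule. [cite: Rump2012, Cor 4.4 eq. (4.6)–(4.7)] -/
theorem corollary44₁ (hp : 2 ≤ p) (hfl : IsRoundNearest p emin fl) (hsym : ∀ t, fl (-t) = -fl t)
    (qs : List ℚ) (hn : 2 * (((qs.length : ℚ) + 2) * unitRoundoff p) ≤ 1) :
    |flSum fl (qs.map fl) - qs.sum| ≤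
      dotErrBound₁ fl p qs.length ((2 : ℚ) ^ (emin + p - 1)) (ufp (flSumAbs fl (qs.map fl))) := by
  have hp1 : 1 ≤ p := by omega
  have hn1 : ((qs.length : ℚ) + 2) * unitRoundoff p ≤ 1 := by
    have := u_pos (p := p); nlinarith
  have hptF : ∀ x ∈ qs.map fl, IsFloat p emin x := by
    intro x hx; obtain ⟨q, -, rfl⟩ := List.mem_map.mp hx; exact (hfl q).1
  have hS0 := flSumAbs_nonneg hfl hptF
  obtain ⟨hAF, hA0, hAΦ⟩ := boundA₁_facts hp1 hfl qs.length hn1 hS0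
  exact corollary44_of_cases hp1 hfl hsym qs hn1 (isFloat_threshold hp1) le_rfl hAF hA0 hAΦ
    (fun _ hlt => hmid_realmin hp hfl qs.length hn hS0 hlt)

/-- **Corollary 4.4 with `R̂`**: `2(n+2)u ≤ 1`, `emin + p ≤ 0` ⟹
`|s̃ₙ − Σpᵢ| ≤ R̂ = fl(fl(fl((n+2)·u)·r) + realmin)`. [cite: Rump2012, Cor 4.4 eq. (4.6)–(4.7)] -/
theorem corollary44₂ (hp : 2 ≤ p) (he : emin + p ≤ 0) (hfl : IsRoundNearest p emin fl)
    (hsym : ∀ t, fl (-t) = -fl t) (qs : List ℚ) (hn : 2 * (((qs.length : ℚ) + 2) * unitRoundoff p) ≤ 1) :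
    |flSum fl (qs.map fl) - qs.sum| ≤
      dotErrBound₂ fl p qs.length ((2 : ℚ) ^ (emin + p - 1)) (ufp (flSumAbs fl (qs.map fl))) := by
  have hp1 : 1 ≤ p := by omega
  have hn1 : ((qs.length : ℚ) + 2) * unitRoundoff p ≤ 1 := by
    have := u_pos (p := p); nlinarith
  have hptF : ∀ x ∈ qs.map fl, IsFloat p emin x := by
    intro x hx; obtain ⟨q, -, rfl⟩ := List.mem_map.mp hx; exact (hfl q).1
  have hS0 := flSumAbs_nonneg hfl hptF
  obtain ⟨hAF, hA0, hAΦ⟩ := boundA₂_facts hp1 he hfl qs.length hn1 hS0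
  exact corollary44_of_cases hp1 hfl hsym qs hn1 (isFloat_threshold hp1) le_rfl hAF hA0 hAΦ
    (fun _ hlt => hmid_realmin hp hfl qs.length hn hS0 hlt)

/-- **Corollary 4.4 with `R̃` and `ϱ = 3/2·realmin`** under the weaker `(n+2)u ≤ 1`:
`|s̃ₙ − Σpᵢ| ≤ fl(fl((n+2)·fl(u·r)) + 3/2·realmin)`. [cite: Rump2012, Cor 4.4 (last sentence) and Remark 8] -/
theorem corollary44₁_rho (hp : 2 ≤ p) (hfl : IsRoundNearest p emin fl) (hsym : ∀ t, fl (-t) = -fl t)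
    (qs : List ℚ) (hn : ((qs.length : ℚ) + 2) * unitRoundoff p ≤ 1) :
    |flSum fl (qs.map fl) - qs.sum| ≤
      dotErrBound₁ fl p qs.length (3 / 2 * (2 : ℚ) ^ (emin + p - 1)) (ufp (flSumAbs fl (qs.map fl))) := by
  have hp1 : 1 ≤ p := by omega
  have hptF : ∀ x ∈ qs.map fl, IsFloat p emin x := by
    intro x hx; obtain ⟨q, -, rfl⟩ := List.mem_map.mp hx; exact (hfl q).1
  have hS0 := flSumAbs_nonneg hfl hptF
  obtain ⟨hAF, hA0, hAΦ⟩ := boundA₁_facts hp1 hfl qs.length hn hS0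
  exact corollary44_of_cases hp1 hfl hsym qs hn (isFloat_rho hp)
    (by linarith [two_zpow_pos (emin + p - 1)]) hAF hA0 hAΦ (fun _ hlt => hmid_rho hp hfl qs.length hn hS0 hlt)

/-- **Corollary 4.4 with `R̂` and `ϱ = 3/2·realmin`** under `(n+2)u ≤ 1` (and `emin + p ≤ 0`):
`|s̃ₙ − Σpᵢ| ≤ fl(fl(fl((n+2)·u)·r) + 3/2·realmin)`. [cite: Rump2012, Cor 4.4 (last sentence) and Remark 8] -/
theorem corollary44₂_rho (hp : 2 ≤ p) (he : emin + p ≤ 0) (hfl : IsRoundNearest p emin fl)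
    (hsym : ∀ t, fl (-t) = -fl t) (qs : List ℚ) (hn : ((qs.length : ℚ) + 2) * unitRoundoff p ≤ 1) :
    |flSum fl (qs.map fl) - qs.sum| ≤
      dotErrBound₂ fl p qs.length (3 / 2 * (2 : ℚ) ^ (emin + p - 1)) (ufp (flSumAbs fl (qs.map fl))) := by
  have hp1 : 1 ≤ p := by omega
  have hptF : ∀ x ∈ qs.map fl, IsFloat p emin x := by
    intro x hx; obtain ⟨q, -, rfl⟩ := List.mem_map.mp hx; exact (hfl q).1
  have hS0 := flSumAbs_nonneg hfl hptF
  obtain ⟨hAF, hA0, hAΦ⟩ := boundA₂_facts hp1 he hfl qs.length hn hS0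
  exact corollary44_of_cases hp1 hfl hsym qs hn (isFloat_rho hp)
    (by linarith [two_zpow_pos (emin + p - 1)]) hAF hA0 hAΦ (fun _ hlt => hmid_rho hp hfl qs.length hn hS0 hlt)

/-- **Corollary 4.4 for the dot product** `xᵀy` of two vectors of length `n`, `2(n+2)u ≤ 1`, with `r = ufp(S̃ₙ)`
computed by Algorithm 3.6 (`Rump2009.ufpFl`): `|s̃ₙ − xᵀy| ≤ R̃ = fl(fl((n+2)·fl(u·r)) + realmin)`.
[cite: Rump2012, Cor 4.4 eq. (4.7)] -/
theorem corollary44_dot (hp : 2 ≤ p) (hfl : IsRoundNearest p emin fl) (hsym : ∀ t, fl (-t) = -fl t)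
    (xs ys : List ℚ) (hlen : ys.length = xs.length)
    (hn : 2 * (((xs.length : ℚ) + 2) * unitRoundoff p) ≤ 1) :
    |flDot fl xs ys - (List.zipWith (· * ·) xs ys).sum| ≤
      dotErrBound₁ fl p xs.length ((2 : ℚ) ^ (emin + p - 1)) (ufpFl fl p (flDotAbs fl xs ys)) := by
  have hl : (List.zipWith (· * ·) xs ys).length = xs.length := by simp [hlen]
  have hptF : ∀ x ∈ flProducts fl xs ys, IsFloat p emin x := by
    intro x hx; obtain ⟨q, -, rfl⟩ := List.mem_map.mp hx; exact (hfl q).1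
  rw [flDotAbs, ufpFl_eq_ufp hp hfl (isFloat_flSumAbs hfl hptF)]
  have h := corollary44₁ hp hfl hsym (List.zipWith (· * ·) xs ys) (by rw [hl]; exact hn)
  rw [hl] at h
  exact h

end Literature.ComputerArithmetic.Rump2012
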